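import Literature.Probability.RandomPlanarGeometry.YangBaxterSAWGeneralDomain
import HarnessLib

/-!
# Glazman–Manolescu's Lemma 2.1 at a single rhombus: the per-plaquette unwound criterion

Rider on `YangBaxterSAWGeneralDomain.lean`. There the vertex relation (Lemma 2.1 (CR) of
[GlazmanManolescu2019], Lemma 1 of [DuminilCopinSmirnov2012]) is proved at EVERY rhombus `r ∈ D` for a
root `a` satisfying the GLOBAL hypothesis `RootUnwound D a` (no excursion polygon of any walk from `a`, at
any rhombus, winds around the midpoint of `a`), discharged for outer roots. The grouping argument is
local to the rhombus: this file records the PER-PLAQUETTE form. For a non-interior root `a` and ONE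
rhombus `r ∈ D`, if no excursion polygon AT `r` (a walk from `a` of class `B2a` at `r`: first hit of `∂r`,
one arc of `r`, an excursion in `D ∖ r` back to `∂r`, closed by the chord of `r`) winds around the
midpoint of `a` (`UnwoundAt D a r`), then Lemma 2.1 holds at `r` (`lem21_of_unwoundAt`), hence the
square-frame relation (`sqRelation_of_unwoundAt`) and, in the barrier catalogue's vocabulary, the
Yang–Baxter vertex identity of the printed weights at `r` (`vertexFunctional_printed_eq_zero_of_unwoundAt`)
— for hole roots as well as outer roots. In particular the identity holds at every plaquette admitting no
excursion at all (`vertexFunctional_printed_eq_zero_of_no_excursion`), e.g. at a plaquette with at most two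
sides leading into the domain. (Venture lane «pcv-sawmu», seat b-step0: the provable half of the lane's
«encircling-excursion criterion» for thick hole roots; the other half — no cancellation among winding
groups — is data, HOME `code/step0/g14/thick/`.)

The proofs are those of `YangBaxterSAWGeneralDomain.lean` with the hypothesis localised; its private
plumbing is read via `open private … from` (`Batteries.Tactic.OpenPrivate`, as in the catalogue's
`PlaquetteWalkYBCurveIdentity.lean`).

References: A. Glazman, I. Manolescu, arXiv:1708.00395v3, Lemma 2.1 and its proof [GlazmanManolescu2019];
H. Duminil-Copin, S. Smirnov, Ann. of Math. 175 (2012), Lemma 1 and its proof [DuminilCopinSmirnov2012];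
A. Glazman, Electron. Commun. Probab. 20 (2015) no. 86, Lemma 3.1 [Glazman2015WeightedSAW].
-/

noncomputable section

open Real Complex

namespace Literature.Probability.RandomPlanarGeometry.SAW.YangBaxter

/-! ### Access to the plumbing of `YangBaxterSAWGeneralDomain` (private there)

The class predicate `ΩG.IsB2a` and the lemmas of the excursion analysis are private in the parent file;
they are re-exported here under their original names (`Batteries.Tactic.OpenPrivate`), which also makes
`ΩG.IsB2a` available to later files. -/

namespace ΩG
export private IsB2a fh_lt AJ_prefix_step Qp_zero Qp_one Qp_two qQ_w pJ_closed pJ_eq_toC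
  sdot_pJpt_midPt sdot_pJpt_w sdot_rung_w three_le_Mv hopfQ T_eq S₂_eq S₁_eq qQ_X
  returnSide_of_isB2a rev_isB2a rev_firstSide rev_exitSide rev_fst rev_WE WE_eq_WE_pi_div_two_add z₃_spec
  T₃_eq paraWeight_of_isB2a paraWeight_rev rev_extWeight rev_WP rev_z₃ sum_B2b sum_split rev_ne rev_rev
  AJ_root_eq_AJ_ctr AJ_ctr_eq_AJ_corner AJ_ctr_eq_zero_of_beyond
  from Literature.Probability.RandomPlanarGeometry.YangBaxterSAWGeneralDomain
end ΩG

namespace YBWalk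
export private nth_firstHitG sides_distinctG exitSide_specG arcFace_ne_of_excursionG arcFace_ne_of_lt_firstHitG
  firstHit_add_three_le_returnHitG from Literature.Probability.RandomPlanarGeometry.YangBaxterSAWGeneralDomain
end YBWalk

export private slantPot_sideW slantPot_sideE slantPot_sideS slantPot_sideN
  from Literature.Probability.RandomPlanarGeometry.YangBaxterSAWGeneralDomain

variable {D : Set Face} {a : MidEdge} {r : Face}

/-- **No excursion polygon at the rhombus `r` winds around the root** (the per-plaquette form of the
tree's `RootUnwound`): for every walk from `a` of class `B2a` at `r`, the closed polygon `J` (excursion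
outside `r` plus the chord of `r`) has winding angle `0` at the midpoint of the root mid-edge `a`.
[cite: GlazmanManolescu2019, Lemma 2.1 (statement, "in the form given in [Gl]"); Glazman2015WeightedSAW, Lemma 3.1 (proof: the winding of the grouped walks)] -/
def UnwoundAt (D : Set Face) (a : MidEdge) (r : Face) : Prop :=
  ∀ (hr : RootedFace D a r) (ω : ΩG D a r) (h : ω.IsB2a), ω.AJ hr h (toC (midPt a)) = 0

/-- A globally unwound root is unwound at every rhombus. [cite: GlazmanManolescu2019, Lemma 2.1 (statement, "in the form given in [Gl]"); Glazman2015WeightedSAW, Lemma 3.1 (proof)] -/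
theorem unwoundAt_of_rootUnwound (hU : RootUnwound D a) (r : Face) : UnwoundAt D a r :=
  fun hr ω h => hU r hr ω h

/-- Outer roots are unwound at every rhombus. [cite: DuminilCopinSmirnov2012, Lemma 1 (a ∈ ∂Ω)] -/
theorem unwoundAt_of_outerRoot (hO : OuterRoot D a) (r : Face) : UnwoundAt D a r :=
  unwoundAt_of_rootUnwound (rootUnwound_of_outerRoot hO) r

/-- **Vacuous case**: a rhombus with no walk of class `B2a` from `a` (no excursion returns to it) is unwound.
[cite: GlazmanManolescu2019, Lemma 2.1 (statement, "in the form given in [Gl]"); Glazman2015WeightedSAW, Lemma 3.1 (proof)] -/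
theorem unwoundAt_of_no_excursion (h : ∀ (ω : ΩG D a r), ¬ω.IsB2a) : UnwoundAt D a r :=
  fun _ ω hω => absurd hω (h ω)

/-- **Transport of the winding of `J` along a king chain of exterior faces**: if the faces `g 0, …, g n` lie
outside `D`, consecutive ones share a corner and the root `a` is a side of `g 0`, then the winding of every
excursion polygon around the midpoint of `a` equals its winding around the centre of `g n`. (So `UnwoundAt D a r`
depends only on the king-component of the exterior face of `a` in the complement: for a hole root it says that
no excursion polygon at `r` winds around the hole.) [cite: GlazmanManolescu2019, Lemma 2.1 (statement, "in the form given in [Gl]"); Glazman2015WeightedSAW, Lemma 3.1 (proof)] -/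
theorem ΩG.AJ_root_eq_AJ_ctr_of_chain {ω : ΩG D a r} (hr : RootedFace D a r) (h : ω.IsB2a) {n : ℕ} {g : ℕ → Face}
    (hroot : ∃ s : Side, (g 0).side s = a) (hD : ∀ i ≤ n, g i ∉ D)
    (hlink : ∀ i < n, ∃ q : ℤ × ℤ, IsCornerOf q (g i) ∧ IsCornerOf q (g (i + 1))) :
    ω.AJ hr h (toC (midPt a)) = ω.AJ hr h (toC (Face.ctr (g n))) := by
  obtain ⟨s, hs⟩ := hroot
  rw [ω.AJ_root_eq_AJ_ctr (hr := hr) h (hD 0 (Nat.zero_le _)) hs]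
  have key : ∀ m ≤ n, ω.AJ hr h (toC (Face.ctr (g 0))) = ω.AJ hr h (toC (Face.ctr (g m))) := by
    intro m
    induction m with
    | zero => intro; rfl
    | succ m ih =>
      intro hm
      obtain ⟨q, hq1, hq2⟩ := hlink m (by omega)
      rw [ih (by omega), ω.AJ_ctr_eq_AJ_corner (hr := hr) h (hD m (by omega)) hq1,
        ← ω.AJ_ctr_eq_AJ_corner (hr := hr) h (hD (m + 1) hm) hq2]
  exact key n le_rfl

/-- **The unwound criterion seen from the hole**: `r` is unwound for the root `a` as soon as, for some face `g`
king-joined to the exterior face of `a` through faces outside `D`, no excursion polygon at `r` winds around the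
centre of `g`. [cite: GlazmanManolescu2019, Lemma 2.1 (statement, "in the form given in [Gl]"); Glazman2015WeightedSAW, Lemma 3.1 (proof)] -/
theorem unwoundAt_of_chain {n : ℕ} {g : ℕ → Face} (hroot : ∃ s : Side, (g 0).side s = a) (hD : ∀ i ≤ n, g i ∉ D)
    (hlink : ∀ i < n, ∃ q : ℤ × ℤ, IsCornerOf q (g i) ∧ IsCornerOf q (g (i + 1)))
    (h0 : ∀ (hr : RootedFace D a r) (ω : ΩG D a r) (h : ω.IsB2a), ω.AJ hr h (toC (Face.ctr (g n))) = 0) :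
    UnwoundAt D a r := by
  intro hr ω h
  rw [ΩG.AJ_root_eq_AJ_ctr_of_chain hr h hroot hD hlink]
  exact h0 hr ω h

/-- **A rhombus with at most two «doors» carries no excursion.** A walk of class `B2a` at `r` crosses three
distinct sides of `r` — at the first hit, at the exit and at the return — and each of them is either an interior
edge of the domain (both its plaquettes in `D`) or, for the first hit only, the root itself. Hence if at most two
sides of `r` are interior-or-root, no walk from `a` is of class `B2a` at `r`.
[cite: GlazmanManolescu2019, Lemma 2.1 (statement, "in the form given in [Gl]"); Glazman2015WeightedSAW, Lemma 3.1 (proof: the classes of walks)] -/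
theorem ΩG.not_isB2a_of_two_doors (hr : RootedFace D a r) (s₁ s₂ : Side)
    (hdoors : ∀ s : Side, (((r.side s).faces.1 ∈ D ∧ (r.side s).faces.2 ∈ D) ∨ r.side s = a) → s = s₁ ∨ s = s₂)
    (ω : ΩG D a r) : ¬ω.IsB2a := by
  intro h
  have hB2 : ω.2.firstHitG + 1 < ω.2.arcs.length := h.1
  have hret : ω.2.returnHitG hB2 = ω.2.arcs.length := h.2
  have h3 := ω.2.firstHit_add_three_le_returnHitG hr hB2
  have hd := ω.2.sides_distinctG hr hB2
  rw [ω.returnSide_of_isB2a h] at hd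
  -- an arc of the domain through `r.side z` in a plaquette other than `r` makes `r.side z` an interior edge
  have door : ∀ {i : ℕ} {z : Side} (hi : i < ω.2.arcs.length),
      (ω.2.nth i = r.side z ∨ ω.2.nth (i + 1) = r.side z) → arcFace (ω.2.nth i, ω.2.nth (i + 1)) ≠ some r →
      ((r.side z).faces.1 ∈ D ∧ (r.side z).faces.2 ∈ D) := by
    intro i z hi hz hne
    obtain ⟨f, hfD, hf⟩ := ω.2.arc_nth hi
    obtain ⟨-, h1, h2⟩ := MidEdge.commonFace_eq_some hf
    have hfr : f ≠ r := fun e => hne (e ▸ hf)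
    have hf' : f = (r.side z).faces.1 ∨ f = (r.side z).faces.2 := by
      rcases hz with hz | hz
      · rw [← hz]; exact h1
      · rw [← hz]; exact h2
    have hr' : r = (r.side z).faces.1 ∨ r = (r.side z).faces.2 := (Face.exists_side_eq_iff r (r.side z)).1 ⟨z, rfl⟩
    rcases hf' with e | e <;> rcases hr' with e' | e'
    · exact absurd (e.trans e'.symm) hfr
    · exact ⟨e ▸ hfD, e' ▸ hr.1⟩
    · exact ⟨e' ▸ hr.1, e ▸ hfD⟩
    · exact absurd (e.trans e'.symm) hfr
  have hz1 : ((r.side (ω.2.exitSideG hr (by omega))).faces.1 ∈ D ∧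
      (r.side (ω.2.exitSideG hr (by omega))).faces.2 ∈ D) :=
    door (i := ω.2.firstHitG + 1) (by omega) (Or.inl (ω.2.exitSide_specG hr (by omega)).1)
      (ω.2.arcFace_ne_of_excursionG hr hB2 (by omega) (by rw [hret]; omega))
  have hz2 : ((r.side ω.1).faces.1 ∈ D ∧ (r.side ω.1).faces.2 ∈ D) :=
    door (i := ω.2.arcs.length - 1) (by omega)
      (Or.inr (by rw [show ω.2.arcs.length - 1 + 1 = ω.2.arcs.length from by omega, ω.2.nth_length]))
      (ω.2.arcFace_ne_of_excursionG hr hB2 (i := ω.2.arcs.length - 1) (by omega) (by rw [hret]; omega))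
  have hz0 : ((r.side ω.2.firstSideG).faces.1 ∈ D ∧ (r.side ω.2.firstSideG).faces.2 ∈ D) ∨
      r.side ω.2.firstSideG = a := by
    rcases Nat.eq_zero_or_pos ω.2.firstHitG with h0 | hpos
    · right
      have e := ω.2.nth_firstHitG
      rw [h0, ω.2.nth_zero] at e
      exact e.symm
    · left
      exact door (i := ω.2.firstHitG - 1) (by omega)
        (Or.inr (by rw [show ω.2.firstHitG - 1 + 1 = ω.2.firstHitG from by omega, ω.2.nth_firstHitG]))
        (ω.2.arcFace_ne_of_lt_firstHitG (by omega) (by omega))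
  rcases hdoors _ hz0 with e0 | e0 <;> rcases hdoors _ (Or.inl hz1) with e1 | e1 <;>
    rcases hdoors _ (Or.inl hz2) with e2 | e2 <;>
    first
    | exact hd.1 (e1.trans e0.symm)
    | exact hd.2.1 (e2.trans e0.symm)
    | exact hd.2.2 (e2.trans e1.symm)

/-- **The excursion windings at one rhombus** (per-plaquette form of `ExcursionWindingGen`).
[cite: GlazmanManolescu2019, Lemma 2.1 (statement, "in the form given in [Gl]"); Glazman2015WeightedSAW, Lemma 3.1 (proof)] -/
def ExcursionWindingAt (D : Set Face) (a : MidEdge) (r : Face) : Prop :=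
  ∀ (Θ : ℤ → ℝ), (∀ k, Θ k ∈ Set.Icc (π / 3) (2 * π / 3)) →
    ∀ (hr : RootedFace D a r) (ω : ΩG D a r) (h : ω.IsB2a),
      ω.WE Θ = excursionWinding (Θ r.1) ω.2.firstSideG (ω.2.exitSideG hr (ω.fh_lt h)) ω.1

namespace ΩG

section PathAt

variable {ω : ΩG D a r} {hr : RootedFace D a r}

/-- `J` does not wind around `m₀` (transport from the root along the prefix), per walk. [folklore] -/
private theorem AJ_m₀_at {h : ω.IsB2a} (hU : ω.AJ hr h (toC (midPt a)) = 0) : ω.AJ hr h (ω.qQ hr h 0) = 0 := by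
  have key : ∀ i ≤ ω.2.firstHitG, ω.AJ hr h (toC (midPt (ω.2.nth i))) = 0 := by
    intro i hi
    induction i with
    | zero => rw [ω.2.nth_zero]; exact hU
    | succ i ih => rw [← ω.AJ_prefix_step h (by omega)]; exact ih (by omega)
  have := key _ le_rfl
  rwa [ω.2.nth_firstHitG, midPt_side, ← Qp_zero h] at this

/-- `J` does not wind around `w`, per walk. [folklore] -/
private theorem AJ_w_at {h : ω.IsB2a} (hU : ω.AJ hr h (toC (midPt a)) = 0)
    (hc : Canon ω.2.firstSideG (ω.z1 hr h) ω.1) :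
    ω.AJ hr h (ω.qQ hr h (ω.mQ hr h + 1)) = 0 := by
  rw [← AJ_m₀_at hU, qQ_w h, eq_comm, qQ, Qp_zero h]
  refine sweep_eq_sweep_of_closed _ _ _ _ (ω.pJ_closed h) (fun k hk => ?_) (fun k hk => ?_) (fun k hk => ?_)
  · rw [pJ_eq_toC, pJ_eq_toC, re_seg, ← midPt_side, ← ω.2.nth_firstHitG]
    exact_mod_cast ω.sdot_pJpt_midPt h le_rfl hk
  · rw [pJ_eq_toC, pJ_eq_toC, re_seg]; exact_mod_cast ω.sdot_pJpt_w h hc hk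
  · rw [pJ_eq_toC, re_seg]; exact_mod_cast ω.sdot_rung_w h hc hk

/-- The right-angle winding of a canonical excursion whose polygon does not wind around the root is the
local constant, per walk. [folklore] -/
private theorem WE_pi_div_two_eq_Loc_at {h : ω.IsB2a} (hU : ω.AJ hr h (toC (midPt a)) = 0)
    (hc : Canon ω.2.firstSideG (ω.z1 hr h) ω.1) :
    ω.WE (fun _ => π / 2) = Loc ω.2.firstSideG (ω.z1 hr h) ω.1 := by
  have hM := three_le_Mv hr h
  have key := ω.hopfQ h hc
  rw [ω.T_eq h, ω.S₂_eq h, ω.S₁_eq h hc, AJ_m₀_at hU, AJ_w_at hU hc, zero_add, zero_add] at key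
  have e0 : ω.qQ hr h 0 = toC (r.base + ω.2.firstSideG.offset) := by rw [qQ, Qp_zero h]
  have e1 : ω.qQ hr h 1 = toC (r.base + ω.2.firstSideG.inOff) := by rw [qQ, Qp_one h]
  have e2 : ω.qQ hr h 2 = toC (r.base + (ω.z1 hr h).inOff) := by rw [qQ, Qp_two h]
  have eq : ω.qQ hr h (2 * ω.Mv) = toC (r.base + Xo ω.2.firstSideG (ω.z1 hr h) ω.1 0) := by
    have := ω.qQ_X (hr := hr) h (i := 0) (by omega); rwa [add_zero] at this
  have ew := ω.qQ_w (hr := hr) h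
  have hL₂ : (angAt (ω.qQ hr h 0) (ω.qQ hr h 1) (ω.qQ hr h 2) -
      angAt (ω.qQ hr h 0) (ω.qQ hr h (2 * ω.Mv)) (toC (r.base + ω.1.inOff)) -
      angAt (ω.qQ hr h 0) (toC (r.base + ω.1.inOff)) (ω.qQ hr h 2) +
      ∑ i ∈ Finset.range (ω.τ hr h + 1), angAt (ω.qQ hr h 0) (ω.qQ hr h (2 * ω.Mv + i)) (ω.qQ hr h (2 * ω.Mv + 1 + i))) =
      L₂off ω.2.firstSideG (ω.z1 hr h) ω.1 := by
    rw [L₂off, e0, e1, e2, eq, angAt_transl, angAt_transl, angAt_transl, τ]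
    congr 1
    refine Finset.sum_congr rfl fun i hi => ?_
    rw [Finset.mem_range] at hi
    rw [ω.qQ_X h (by unfold τ; omega), show 2 * ω.Mv + 1 + i = 2 * ω.Mv + (i + 1) by ring, ω.qQ_X h (by unfold τ; omega),
      angAt_transl]
  have hL₁ : (angAt (ω.qQ hr h (ω.mQ hr h + 1)) (ω.qQ hr h 0) (ω.qQ hr h 1) +
      angAt (ω.qQ hr h (ω.mQ hr h + 1)) (ω.qQ hr h 1) (ω.qQ hr h 2) -
      angAt (ω.qQ hr h (ω.mQ hr h + 1)) (ω.qQ hr h (2 * ω.Mv)) (toC (r.base + ω.1.inOff)) -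
      angAt (ω.qQ hr h (ω.mQ hr h + 1)) (toC (r.base + ω.1.inOff)) (ω.qQ hr h 2) +
      ∑ i ∈ Finset.range (ω.τ hr h), angAt (ω.qQ hr h (ω.mQ hr h + 1)) (ω.qQ hr h (2 * ω.Mv + i)) (ω.qQ hr h (2 * ω.Mv + 1 + i))) =
      L₁off ω.2.firstSideG (ω.z1 hr h) ω.1 := by
    rw [L₁off, ew, e0, e1, e2, eq, angAt_transl, angAt_transl, angAt_transl, angAt_transl, τ]
    congr 1
    refine Finset.sum_congr rfl fun i hi => ?_
    rw [Finset.mem_range] at hi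
    rw [ω.qQ_X h (by unfold τ; omega), show 2 * ω.Mv + 1 + i = 2 * ω.Mv + (i + 1) by ring, ω.qQ_X h (by unfold τ; omega),
      angAt_transl]
  have hT : ∑ i ∈ Finset.range (ω.τ hr h), ω.extQ hr h (2 * ω.Mv + i) = tailExtOff ω.2.firstSideG (ω.z1 hr h) ω.1 := by
    rw [tailExtOff, τ]
    refine Finset.sum_congr rfl fun i hi => ?_
    rw [Finset.mem_range] at hi
    unfold extQ
    rw [show 2 * ω.Mv + i + 2 = 2 * ω.Mv + (i + 2) by ring, show 2 * ω.Mv + i + 1 = 2 * ω.Mv + (i + 1) by ring,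
      ω.qQ_X h (by unfold τ; omega), ω.qQ_X h (by unfold τ; omega), ω.qQ_X h (by unfold τ; omega), ← toC_sub, ← toC_sub,
      add_sub_add_left_eq_sub, add_sub_add_left_eq_sub]
  rw [hL₂, hL₁, hT] at key
  rw [Loc]
  linarith

end PathAt

/-! #### The winding of an ARBITRARY excursion: the local constant plus twice the winding of `J` around the root

No hypothesis on the root: Hopf's open-path identity (`hopfQ`) splits the turning of the excursion into the
angle swept from its start (`S₂ = AJ(m₀′) + …`) and from its end (`S₁ = AJ(w) + …`); the two swept angles of
the closed polygon `J` agree (`AJ(w) = AJ(m₀′)`, acute-angle transport inside `r`) and equal the winding of `J`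
around the midpoint of the root (transport along the prefix). Hence `WE = Loc + 2·AJ(midPt a)` at right angles
for a canonically oriented excursion: a WOUND excursion (`AJ = ±2π`) has its winding shifted by `±4π` — it goes
round the hole the other way — and its parafermionic phase multiplied by `e^{∓iπ/2}`. (First brick of the
lane's «root-plaquette defect law for arbitrary hole roots», HOME `code/step0/g14/DESIGN-next-2.md`.) -/

section Wound

variable {ω : ΩG D a r} {hr : RootedFace D a r}

/-- The winding of `J` around the first-hit point equals its winding around the root midpoint (transport
along the prefix; no hypothesis). [cite: GlazmanManolescu2019, Lemma 2.1 (statement, "in the form given in [Gl]"); Glazman2015WeightedSAW, Lemma 3.1 (proof)] -/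
theorem AJ_qQ_zero_eq_AJ_root {h : ω.IsB2a} : ω.AJ hr h (ω.qQ hr h 0) = ω.AJ hr h (toC (midPt a)) := by
  have key : ∀ i ≤ ω.2.firstHitG, ω.AJ hr h (toC (midPt (ω.2.nth i))) = ω.AJ hr h (toC (midPt a)) := by
    intro i hi
    induction i with
    | zero => rw [ω.2.nth_zero]
    | succ i ih => rw [← ω.AJ_prefix_step h (by omega)]; exact ih (by omega)
  have := key _ le_rfl
  rwa [ω.2.nth_firstHitG, midPt_side, ← Qp_zero h] at this

/-- The two swept angles of `J` (from the end point `w` and from the first-hit point) agree (no hypothesis).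
[cite: GlazmanManolescu2019, Lemma 2.1 (statement, "in the form given in [Gl]"); Glazman2015WeightedSAW, Lemma 3.1 (proof)] -/
theorem AJ_w_eq_AJ_qQ_zero {h : ω.IsB2a} (hc : Canon ω.2.firstSideG (ω.z1 hr h) ω.1) :
    ω.AJ hr h (ω.qQ hr h (ω.mQ hr h + 1)) = ω.AJ hr h (ω.qQ hr h 0) := by
  rw [qQ_w h, eq_comm, qQ, Qp_zero h]
  refine sweep_eq_sweep_of_closed _ _ _ _ (ω.pJ_closed h) (fun k hk => ?_) (fun k hk => ?_) (fun k hk => ?_)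
  · rw [pJ_eq_toC, pJ_eq_toC, re_seg, ← midPt_side, ← ω.2.nth_firstHitG]
    exact_mod_cast ω.sdot_pJpt_midPt h le_rfl hk
  · rw [pJ_eq_toC, pJ_eq_toC, re_seg]; exact_mod_cast ω.sdot_pJpt_w h hc hk
  · rw [pJ_eq_toC, re_seg]; exact_mod_cast ω.sdot_rung_w h hc hk

/-- ★ **The right-angle winding of a canonically oriented excursion is the local constant plus TWICE the winding of
its polygon around the root** (no hypothesis on the root). [cite: GlazmanManolescu2019, Lemma 2.1 (statement, "in the form given in [Gl]"); Glazman2015WeightedSAW, Lemma 3.1 (proof)] -/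
theorem WE_pi_div_two_eq_Loc_add_two_AJ {h : ω.IsB2a} (hc : Canon ω.2.firstSideG (ω.z1 hr h) ω.1) :
    ω.WE (fun _ => π / 2) = Loc ω.2.firstSideG (ω.z1 hr h) ω.1 + 2 * ω.AJ hr h (toC (midPt a)) := by
  have hM := three_le_Mv hr h
  have key := ω.hopfQ h hc
  rw [ω.T_eq h, ω.S₂_eq h, ω.S₁_eq h hc, AJ_w_eq_AJ_qQ_zero hc, AJ_qQ_zero_eq_AJ_root] at key
  have e0 : ω.qQ hr h 0 = toC (r.base + ω.2.firstSideG.offset) := by rw [qQ, Qp_zero h]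
  have e1 : ω.qQ hr h 1 = toC (r.base + ω.2.firstSideG.inOff) := by rw [qQ, Qp_one h]
  have e2 : ω.qQ hr h 2 = toC (r.base + (ω.z1 hr h).inOff) := by rw [qQ, Qp_two h]
  have eq : ω.qQ hr h (2 * ω.Mv) = toC (r.base + Xo ω.2.firstSideG (ω.z1 hr h) ω.1 0) := by
    have := ω.qQ_X (hr := hr) h (i := 0) (by omega); rwa [add_zero] at this
  have ew := ω.qQ_w (hr := hr) h
  have hL₂ : (angAt (ω.qQ hr h 0) (ω.qQ hr h 1) (ω.qQ hr h 2) -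
      angAt (ω.qQ hr h 0) (ω.qQ hr h (2 * ω.Mv)) (toC (r.base + ω.1.inOff)) -
      angAt (ω.qQ hr h 0) (toC (r.base + ω.1.inOff)) (ω.qQ hr h 2) +
      ∑ i ∈ Finset.range (ω.τ hr h + 1), angAt (ω.qQ hr h 0) (ω.qQ hr h (2 * ω.Mv + i)) (ω.qQ hr h (2 * ω.Mv + 1 + i))) =
      L₂off ω.2.firstSideG (ω.z1 hr h) ω.1 := by
    rw [L₂off, e0, e1, e2, eq, angAt_transl, angAt_transl, angAt_transl, τ]
    congr 1
    refine Finset.sum_congr rfl fun i hi => ?_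
    rw [Finset.mem_range] at hi
    rw [ω.qQ_X h (by unfold τ; omega), show 2 * ω.Mv + 1 + i = 2 * ω.Mv + (i + 1) by ring, ω.qQ_X h (by unfold τ; omega),
      angAt_transl]
  have hL₁ : (angAt (ω.qQ hr h (ω.mQ hr h + 1)) (ω.qQ hr h 0) (ω.qQ hr h 1) +
      angAt (ω.qQ hr h (ω.mQ hr h + 1)) (ω.qQ hr h 1) (ω.qQ hr h 2) -
      angAt (ω.qQ hr h (ω.mQ hr h + 1)) (ω.qQ hr h (2 * ω.Mv)) (toC (r.base + ω.1.inOff)) -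
      angAt (ω.qQ hr h (ω.mQ hr h + 1)) (toC (r.base + ω.1.inOff)) (ω.qQ hr h 2) +
      ∑ i ∈ Finset.range (ω.τ hr h), angAt (ω.qQ hr h (ω.mQ hr h + 1)) (ω.qQ hr h (2 * ω.Mv + i)) (ω.qQ hr h (2 * ω.Mv + 1 + i))) =
      L₁off ω.2.firstSideG (ω.z1 hr h) ω.1 := by
    rw [L₁off, ew, e0, e1, e2, eq, angAt_transl, angAt_transl, angAt_transl, angAt_transl, τ]
    congr 1
    refine Finset.sum_congr rfl fun i hi => ?_
    rw [Finset.mem_range] at hi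
    rw [ω.qQ_X h (by unfold τ; omega), show 2 * ω.Mv + 1 + i = 2 * ω.Mv + (i + 1) by ring, ω.qQ_X h (by unfold τ; omega),
      angAt_transl]
  have hT : ∑ i ∈ Finset.range (ω.τ hr h), ω.extQ hr h (2 * ω.Mv + i) = tailExtOff ω.2.firstSideG (ω.z1 hr h) ω.1 := by
    rw [tailExtOff, τ]
    refine Finset.sum_congr rfl fun i hi => ?_
    rw [Finset.mem_range] at hi
    unfold extQ
    rw [show 2 * ω.Mv + i + 2 = 2 * ω.Mv + (i + 2) by ring, show 2 * ω.Mv + i + 1 = 2 * ω.Mv + (i + 1) by ring,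
      ω.qQ_X h (by unfold τ; omega), ω.qQ_X h (by unfold τ; omega), ω.qQ_X h (by unfold τ; omega), ← toC_sub, ← toC_sub,
      add_sub_add_left_eq_sub, add_sub_add_left_eq_sub]
  rw [hL₂, hL₁, hT] at key
  rw [Loc]
  linarith

/-- ★★ **Winding law for an arbitrary excursion, canonical orientation**: at every angle sequence,
`WE = excursionWinding(θ_r; z₀,z₁,z₂) + 2·AJ(midPt a)`. [cite: GlazmanManolescu2019, Lemma 2.1 (statement, "in the form given in [Gl]"); Glazman2015WeightedSAW, Lemma 3.1 (proof)] -/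
theorem WE_eq_excursionWinding_add_two_AJ (hr : RootedFace D a r) {h : ω.IsB2a}
    (hc : Canon ω.2.firstSideG (ω.z1 hr h) ω.1) (Θ : ℤ → ℝ) :
    ω.WE Θ = excursionWinding (Θ r.1) ω.2.firstSideG (ω.2.exitSideG hr (ω.fh_lt h)) ω.1 + 2 * ω.AJ hr h (toC (midPt a)) := by
  have hd := ω.2.sides_distinctG hr h.1
  rw [ω.returnSide_of_isB2a h] at hd
  have key : ω.WE (fun _ => π / 2) = excursionWinding (π / 2) ω.2.firstSideG (ω.2.exitSideG hr (ω.fh_lt h)) ω.1 +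
      2 * ω.AJ hr h (toC (midPt a)) := by
    have hL := Loc_eq hc
    have hW := WE_pi_div_two_eq_Loc_add_two_AJ (ω := ω) (hr := hr) hc
    unfold ΩG.z1 at hL hW
    linarith
  rw [ω.WE_eq_WE_pi_div_two_add hr h Θ, key, excursionWinding_theta (Θ r.1) hd.1.symm hd.2.1.symm hd.2.2.symm]
  ring

/-- ★★ **Winding law, swapped orientation**: if the REVERSED companion is canonically oriented, then
`WE(ω) = excursionWinding(θ_r; z₀,z₁,z₂) − 2·AJ_{rev ω}(midPt a)` (one of the two orientations always is canonical,
`canon_or_swap`). [cite: GlazmanManolescu2019, Lemma 2.1 (statement, "in the form given in [Gl]"); Glazman2015WeightedSAW, Lemma 3.1 (proof)] -/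
theorem WE_eq_excursionWinding_sub_two_AJ_rev (hr : RootedFace D a r) {h : ω.IsB2a}
    (hc : Canon (ω.rev hr).2.firstSideG ((ω.rev hr).z1 hr (ω.rev_isB2a hr h)) (ω.rev hr).1) (Θ : ℤ → ℝ) :
    ω.WE Θ = excursionWinding (Θ r.1) ω.2.firstSideG (ω.2.exitSideG hr (ω.fh_lt h)) ω.1 -
      2 * (ω.rev hr).AJ hr (ω.rev_isB2a hr h) (toC (midPt a)) := by
  have hd := ω.2.sides_distinctG hr h.1
  rw [ω.returnSide_of_isB2a h] at hd
  have key : ω.WE (fun _ => π / 2) = excursionWinding (π / 2) ω.2.firstSideG (ω.2.exitSideG hr (ω.fh_lt h)) ω.1 -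
      2 * (ω.rev hr).AJ hr (ω.rev_isB2a hr h) (toC (midPt a)) := by
    have e := WE_pi_div_two_eq_Loc_add_two_AJ (ω := ω.rev hr) (h := ω.rev_isB2a hr h) hc
    unfold ΩG.z1 at e
    rw [ω.rev_WE (fun _ => π / 2) hr h, ω.rev_firstSide hr h, ω.rev_exitSide hr h, ω.rev_fst hr h] at e
    have hc' : Canon ω.2.firstSideG ω.1 (ω.2.exitSideG hr (ω.fh_lt h)) := by
      have := hc; unfold ΩG.z1 at this
      rwa [ω.rev_firstSide hr h, ω.rev_exitSide hr h, ω.rev_fst hr h] at this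
    have hL := Loc_eq hc'
    have hS := excursionWinding_swap (π / 2) ω.2.firstSideG (ω.2.exitSideG hr (ω.fh_lt h)) ω.1
    linarith
  rw [ω.WE_eq_WE_pi_div_two_add hr h Θ, key, excursionWinding_theta (Θ r.1) hd.1.symm hd.2.1.symm hd.2.2.symm]
  ring

/-- **The winding angle of a closed polygon is an integer multiple of `2π`** (telescoping in `Real.Angle`).
[folklore] -/
private theorem sweep_eq_int_mul_two_pi (b : ℂ) (p : ℕ → ℂ) (N : ℕ) (hN : p N = p 0) :
    ∃ n : ℤ, sweep b p N = n * (2 * π) := by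
  have hA : ((sweep b p N : ℝ) : Real.Angle) = 0 := by
    unfold sweep angAt
    have e : ∀ x : ℝ, (x : Real.Angle) = Real.Angle.coeHom x := fun x => rfl
    rw [e, map_sum]
    simp only [← e, Real.Angle.coe_toReal]
    rw [Finset.sum_range_sub (fun k => ((Complex.arg (p k - b) : ℝ) : Real.Angle)), hN, sub_self]
  obtain ⟨n, hn⟩ := Real.Angle.coe_eq_zero_iff.1 hA
  exact ⟨n, by rw [← hn, zsmul_eq_mul]⟩

/-- ★ **The winding of an excursion polygon around any point is `2π·n`, `n ∈ ℤ`** — so a class-`B2a` walk is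
either unwound at the root (`n = 0`) or WOUND with winding shift `±4πn` (by the winding law above).
[cite: GlazmanManolescu2019, Lemma 2.1 (statement, "in the form given in [Gl]"); Glazman2015WeightedSAW, Lemma 3.1 (proof)] -/
theorem AJ_eq_int_mul_two_pi (h : ω.IsB2a) (b : ℂ) : ∃ n : ℤ, ω.AJ hr h b = n * (2 * π) :=
  sweep_eq_int_mul_two_pi b (ω.pJ hr h) (2 * ω.Mv) (ω.pJ_closed h)

end Wound

variable (ω : ΩG D a r)

/-- **An unwound excursion**: a walk of class `B2a` at `r` whose excursion polygon, and that of its reversed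
companion, have winding angle `0` at the midpoint of the root. (The hypothesis on the companion is the same
polygon traversed backwards; it is carried explicitly rather than through a reversal lemma.)
[cite: GlazmanManolescu2019, Lemma 2.1 (statement, "in the form given in [Gl]"); Glazman2015WeightedSAW, Lemma 3.1 (proof)] -/
def Unwound (hr : RootedFace D a r) : Prop :=
  ∀ h : ω.IsB2a, ω.AJ hr h (toC (midPt a)) = 0 ∧ (ω.rev hr).AJ hr (ω.rev_isB2a hr h) (toC (midPt a)) = 0

/-- At an unwound rhombus every walk is unwound. [cite: GlazmanManolescu2019, Lemma 2.1 (statement, "in the form given in [Gl]"); Glazman2015WeightedSAW, Lemma 3.1 (proof)] -/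
theorem unwound_of_unwoundAt (hU : UnwoundAt D a r) (hr : RootedFace D a r) : ω.Unwound hr :=
  fun h => ⟨hU hr ω h, hU hr _ _⟩

/-- The reversed companion of an unwound walk is unwound. [cite: GlazmanManolescu2019, Lemma 2.1 (statement, "in the form given in [Gl]"); Glazman2015WeightedSAW, Lemma 3.1 (proof)] -/
theorem Unwound.rev {hr : RootedFace D a r} {ω : ΩG D a r} (h : ω.IsB2a) (hU : ω.Unwound hr) :
    (ω.rev hr).Unwound hr := by
  intro h'
  refine ⟨(hU h).2, ?_⟩
  have e : (ω.rev hr).rev hr = ω := ω.rev_rev hr h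
  have key : ∀ (ω'' : ΩG D a r) (p : ω''.IsB2a), ω'' = ω → ω''.AJ hr p (toC (midPt a)) = 0 := by
    rintro ω'' p rfl; exact (hU p).1
  exact key _ _ e

/-- **The excursion winding of an unwound walk of class `B2a`** (all orientations, all angles).
[cite: GlazmanManolescu2019, Lemma 2.1 (statement, "in the form given in [Gl]"); Glazman2015WeightedSAW, Lemma 3.1 (proof)] -/
private theorem WE_eq_excursionWinding_of_unwound (hr : RootedFace D a r) (h : ω.IsB2a) (hU : ω.Unwound hr)
    (Θ : ℤ → ℝ) : ω.WE Θ = excursionWinding (Θ r.1) ω.2.firstSideG (ω.2.exitSideG hr (ω.fh_lt h)) ω.1 := by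
  have hd := ω.2.sides_distinctG hr h.1
  rw [ω.returnSide_of_isB2a h] at hd
  have key : ω.WE (fun _ => π / 2) = excursionWinding (π / 2) ω.2.firstSideG (ω.2.exitSideG hr (ω.fh_lt h)) ω.1 := by
    rcases canon_or_swap hd.1.symm hd.2.1.symm hd.2.2.symm with hc | hc
    · rw [WE_pi_div_two_eq_Loc_at (hU h).1 hc]; unfold ΩG.z1; rw [Loc_eq hc]
    · have h'' := ω.rev_isB2a hr h
      have hc' : Canon (ω.rev hr).2.firstSideG ((ω.rev hr).z1 hr h'') (ω.rev hr).1 := by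
        unfold ΩG.z1; rw [ω.rev_firstSide hr h, ω.rev_exitSide hr h, ω.rev_fst hr h]; exact hc
      have e := WE_pi_div_two_eq_Loc_at (ω := ω.rev hr) (h := h'') (hU h).2 hc'
      unfold ΩG.z1 at e
      rw [ω.rev_WE (fun _ => π / 2) hr h, ω.rev_firstSide hr h, ω.rev_exitSide hr h, ω.rev_fst hr h,
        Loc_eq hc, excursionWinding_swap] at e
      linarith
  rw [ω.WE_eq_WE_pi_div_two_add hr h Θ, key, excursionWinding_theta (Θ r.1) hd.1.symm hd.2.1.symm hd.2.2.symm]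

end ΩG

/-- **The excursion windings at an unwound rhombus.** [cite: GlazmanManolescu2019, Lemma 2.1 (statement, "in the form given in [Gl]"); Glazman2015WeightedSAW, Lemma 3.1 (proof)] -/
theorem excursionWindingAt_of_unwoundAt (hU : UnwoundAt D a r) : ExcursionWindingAt D a r :=
  fun Θ _ hr ω h => ω.WE_eq_excursionWinding_of_unwound hr h (ω.unwound_of_unwoundAt hU hr) Θ

namespace ΩG

variable (ω : ΩG D a r) (Θ : ℤ → ℝ)

/-- **The group of an UNWOUND excursion sums to zero** (per walk: the four walks sharing the prefix and the
excursion in either direction cancel by the second local relation). [cite: GlazmanManolescu2019, Lemma 2.1 (statement, "in the form given in [Gl]"); Glazman2015WeightedSAW, Lemma 3.1 (proof)] -/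
theorem G_add_G_rev_of_unwound (hr : RootedFace D a r) (h : ω.IsB2a) (hU : ω.Unwound hr) :
    ω.G Θ hr + (ω.rev hr).G Θ hr = 0 := by
  have h' := ω.rev_isB2a hr h
  have hX := ω.WE_eq_excursionWinding_of_unwound hr h hU Θ
  have hd := ω.2.sides_distinctG hr h.1
  rw [ω.returnSide_of_isB2a h] at hd
  have hz := ω.z₃_spec hr h
  have key := groupTwo_gen (Θ r.1) ω.2.firstSideG (ω.2.exitSideG hr (ω.fh_lt h)) ω.1 (ω.z₃ hr h)
    hd.1.symm hd.2.1.symm hz.1.symm hd.2.2.symm hz.2.1.symm hz.2.2.symm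
  unfold bracket at key
  rw [G, G, g, g, ω.T₃_eq Θ hr h, (ω.rev hr).T₃_eq Θ hr h', ω.paraWeight_of_isB2a Θ hr h,
    ω.paraWeight_rev Θ hr h, ω.rev_extWeight Θ hr h, ω.rev_WP Θ hr h, ω.rev_WE Θ hr h, ω.rev_z₃ hr h,
    ω.rev_firstSide hr h, ω.rev_exitSide hr h, ω.rev_fst hr h, hX]
  have e1 : ∀ a b : ℝ, phase (ω.WP Θ + a + b) = phase (ω.WP Θ) * phase (a + b) := fun a b => by
    rw [add_assoc, phase_add]
  have e2 : ∀ a b c : ℝ, phase (ω.WP Θ + a + b + c) = phase (ω.WP Θ) * phase (a + b + c) := fun a b c => by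
    rw [add_assoc, add_assoc, phase_add, add_assoc]
  have e3 : ∀ a b : ℝ, phase (ω.WP Θ + a - b) = phase (ω.WP Θ) * phase (a - b) := fun a b => by
    rw [add_sub_assoc, phase_add]
  have e4 : ∀ a b c : ℝ, phase (ω.WP Θ + a + -b + c) = phase (ω.WP Θ) * phase (a - b + c) := fun a b c => by
    rw [show ω.WP Θ + a + -b + c = ω.WP Θ + (a - b + c) by ring, phase_add]
  rw [e1, e2, e3, e4]
  linear_combination (ω.2.extWeight Θ r : ℂ) * phase (ω.WP Θ) * key

/-- ★★ **The group of an excursion in closed form, NO hypothesis**: for every class-`B2a` walk ω, the four members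
of its group (ω, its reversed companion, and their one-arc extensions) sum to
`extWeight(ω) · phase(WP(ω)) · bracket(θ_r; z₀, z₁, z₂, z₃; WE(ω))` — Glazman–Manolescu's bracket EVALUATED AT THE
ACTUAL excursion winding. (Unwound: `WE = excursionWinding` and the bracket vanishes by `groupTwo_gen`; wound:
`WE = excursionWinding ± 4πn` by the winding law.) [cite: GlazmanManolescu2019, Lemma 2.1 (statement, "in the form given in [Gl]"); Glazman2015WeightedSAW, Lemma 3.1 (proof)] -/
theorem G_add_G_rev_eq_bracket (hr : RootedFace D a r) (h : ω.IsB2a) :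
    ω.G Θ hr + (ω.rev hr).G Θ hr =
      (ω.2.extWeight Θ r : ℂ) * phase (ω.WP Θ) *
        bracket (Θ r.1) ω.2.firstSideG (ω.2.exitSideG hr (ω.fh_lt h)) ω.1 (ω.z₃ hr h) (ω.WE Θ) := by
  have h' := ω.rev_isB2a hr h
  rw [G, G, g, g, ω.T₃_eq Θ hr h, (ω.rev hr).T₃_eq Θ hr h', ω.paraWeight_of_isB2a Θ hr h,
    ω.paraWeight_rev Θ hr h, ω.rev_extWeight Θ hr h, ω.rev_WP Θ hr h, ω.rev_WE Θ hr h, ω.rev_z₃ hr h,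
    ω.rev_firstSide hr h, ω.rev_exitSide hr h, ω.rev_fst hr h]
  have e1 : ∀ a b : ℝ, phase (ω.WP Θ + a + b) = phase (ω.WP Θ) * phase (a + b) := fun a b => by
    rw [add_assoc, phase_add]
  have e2 : ∀ a b c : ℝ, phase (ω.WP Θ + a + b + c) = phase (ω.WP Θ) * phase (a + b + c) := fun a b c => by
    rw [add_assoc, add_assoc, phase_add, add_assoc]
  have e3 : ∀ a b : ℝ, phase (ω.WP Θ + a - b) = phase (ω.WP Θ) * phase (a - b) := fun a b => by
    rw [add_sub_assoc, phase_add]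
  have e4 : ∀ a b c : ℝ, phase (ω.WP Θ + a + -b + c) = phase (ω.WP Θ) * phase (a - b + c) := fun a b c => by
    rw [show ω.WP Θ + a + -b + c = ω.WP Θ + (a - b + c) by ring, phase_add]
  rw [e1, e2, e3, e4]
  unfold bracket
  ring

/-- **The bracket one full winding further**: shifting the excursion winding by `4πn` multiplies the two
forward members by `e^{−i(5/2)πn}` and the two backward members by `e^{+i(5/2)πn}`. [cite: GlazmanManolescu2019, Lemma 2.1 (statement, "in the form given in [Gl]"); Glazman2015WeightedSAW, Lemma 3.1 (proof), §2.1 (σ = 5/8)] -/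
theorem bracket_add_four_pi_mul (θ : ℝ) (z₀ z₁ z₂ z₃ : Side) (X : ℝ) (n : ℤ) :
    bracket θ z₀ z₁ z₂ z₃ (X + 4 * π * n) =
      Complex.exp ((((-(5 / 2) * π * n : ℝ)) : ℂ) * Complex.I) *
          (crCoef θ z₂ * (arcWeight θ z₀ z₁ : ℂ) * phase (arcTurn θ z₀ z₁ + X) +
            crCoef θ z₃ * (pairWeight θ z₀ z₁ z₂ z₃ : ℂ) * phase (arcTurn θ z₀ z₁ + X + arcTurn θ z₂ z₃)) +
        Complex.exp ((((5 / 2) * π * n : ℝ) : ℂ) * Complex.I) *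
          (crCoef θ z₁ * (arcWeight θ z₀ z₂ : ℂ) * phase (arcTurn θ z₀ z₂ - X) +
            crCoef θ z₃ * (pairWeight θ z₀ z₂ z₁ z₃ : ℂ) * phase (arcTurn θ z₀ z₂ - X + arcTurn θ z₁ z₃)) := by
  have hp : ∀ W : ℝ, phase (W + 4 * π * n) = Complex.exp ((((-(5 / 2) * π * n : ℝ)) : ℂ) * Complex.I) * phase W := by
    intro W; unfold phase; rw [← Complex.exp_add]; congr 1; push_cast; ring
  have hm : ∀ W : ℝ, phase (W - 4 * π * n) = Complex.exp ((((5 / 2) * π * n : ℝ) : ℂ) * Complex.I) * phase W := by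
    intro W; unfold phase; rw [← Complex.exp_add]; congr 1; push_cast; ring
  unfold bracket
  rw [show arcTurn θ z₀ z₁ + (X + 4 * π * n) = (arcTurn θ z₀ z₁ + X) + 4 * π * n by ring,
    show arcTurn θ z₀ z₁ + X + 4 * π * n + arcTurn θ z₂ z₃ = (arcTurn θ z₀ z₁ + X + arcTurn θ z₂ z₃) + 4 * π * n by ring,
    show arcTurn θ z₀ z₂ - (X + 4 * π * n) = (arcTurn θ z₀ z₂ - X) - 4 * π * n by ring,
    show arcTurn θ z₀ z₂ - X - 4 * π * n + arcTurn θ z₁ z₃ = (arcTurn θ z₀ z₂ - X + arcTurn θ z₁ z₃) - 4 * π * n by ring,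
    hp, hp, hm, hm]
  ring

/-- ★★★ **The wound group in closed form (canonical orientation)**: if the excursion polygon of ω winds `n`
times around the root (`AJ = 2πn`), the group of ω contributes
`ext · phase(WP) · [e^{−i5πn/2} − e^{+i5πn/2}] · (−P)` where `P` is the backward half of the bracket at the
tabulated winding — in particular it VANISHES iff `sin(5πn/2) = 0`, i.e. never for `n = ±1`.
Precisely: `G ω + G (rev ω) = ext·phase(WP)·bracket(θ; z's; excursionWinding + 4πn)` with the bracket expanded by
`bracket_add_four_pi_mul` and `groupTwo_gen`. [cite: GlazmanManolescu2019, Lemma 2.1 (statement, "in the form given in [Gl]"); Glazman2015WeightedSAW, Lemma 3.1 (proof)] -/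
theorem G_add_G_rev_of_wound (hr : RootedFace D a r) (h : ω.IsB2a)
    (hc : Canon ω.2.firstSideG (ω.z1 hr h) ω.1) (n : ℤ) (hA : ω.AJ hr h (toC (midPt a)) = n * (2 * π)) :
    ω.G Θ hr + (ω.rev hr).G Θ hr =
      (ω.2.extWeight Θ r : ℂ) * phase (ω.WP Θ) *
        bracket (Θ r.1) ω.2.firstSideG (ω.2.exitSideG hr (ω.fh_lt h)) ω.1 (ω.z₃ hr h)
          (excursionWinding (Θ r.1) ω.2.firstSideG (ω.2.exitSideG hr (ω.fh_lt h)) ω.1 + 4 * π * n) := by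
  rw [ω.G_add_G_rev_eq_bracket Θ hr h, ω.WE_eq_excursionWinding_add_two_AJ hr hc Θ, hA]
  congr 2
  ring

variable [Finite D]

open Classical in
/-- ★★★ **DEFECT LOCALISATION (sum over walks).** For ANY non-interior root and ANY rhombus `r ∈ D`, the
vertex-relation sum over all walks from `a` to `∂r` equals the grouped sum over the WOUND excursions at `r`
alone: classes `A`/`B1` cancel by the first local relation, and every unwound excursion pair by the second.
[cite: GlazmanManolescu2019, Lemma 2.1 (statement, "in the form given in [Gl]"); Glazman2015WeightedSAW, Lemma 3.1 (proof)] -/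
theorem sum_g_eq_sum_wound (hr : RootedFace D a r) (hΘ : ∀ k, Θ k ∈ Set.Icc (π / 3) (2 * π / 3)) :
    ∑ ω : ΩG D a r, ω.g Θ = ∑ ω ∈ (setB2a D a r).filter (fun ω => ¬ω.Unwound hr), ω.G Θ hr := by
  rw [sum_split, add_assoc, sum_A_add_sum_B1 Θ hr hΘ, zero_add, sum_B2b hr, ← Finset.sum_add_distrib]
  change ∑ ω ∈ setB2a D a r, ω.G Θ hr = _
  rw [← Finset.sum_filter_add_sum_filter_not (setB2a D a r) (fun ω => ω.Unwound hr)]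
  have h0 : ∑ ω ∈ (setB2a D a r).filter (fun ω => ω.Unwound hr), ω.G Θ hr = 0 := by
    refine Finset.sum_involution (fun ω _ => ω.rev hr) ?_ ?_ ?_ ?_
    · intro ω hω
      simp only [setB2a, Finset.mem_filter, Finset.mem_univ, true_and] at hω
      exact ω.G_add_G_rev_of_unwound Θ hr hω.1 hω.2
    · intro ω hω _
      simp only [setB2a, Finset.mem_filter, Finset.mem_univ, true_and] at hω
      exact ω.rev_ne hr hω.1
    · intro ω hω
      simp only [setB2a, Finset.mem_filter, Finset.mem_univ, true_and] at hω ⊢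
      exact ⟨ω.rev_isB2a hr hω.1, hω.2.rev hω.1⟩
    · intro ω hω
      simp only [setB2a, Finset.mem_filter, Finset.mem_univ, true_and] at hω
      exact ω.rev_rev hr hω.1
  rw [h0, zero_add]

/-- **The vertex relation as a vanishing sum, per plaquette.** [cite: GlazmanManolescu2019, Lemma 2.1] -/
theorem sum_g_eq_zero_at (hr : RootedFace D a r) (hW : UnwoundAt D a r)
    (hΘ : ∀ k, Θ k ∈ Set.Icc (π / 3) (2 * π / 3)) : ∑ ω : ΩG D a r, ω.g Θ = 0 := by
  classical
  rw [sum_g_eq_sum_wound Θ hr hΘ]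
  refine Finset.sum_eq_zero fun ω hω => ?_
  simp only [setB2a, Finset.mem_filter, Finset.mem_univ, true_and] at hω
  exact absurd (ω.unwound_of_unwoundAt hW hr) hω.2

/-- **The vertex-relation sum is the Lemma-2.1 defect** `F(z_E) − F(z_W) − e^{iθ_r}(F(z_S) − F(z_N))` of the
observable `F = parafermionOn D a Θ`. [cite: GlazmanManolescu2019, Lemma 2.1, eq. (CR)] -/
theorem sum_g_eq_lem21Defect : ∑ ω : ΩG D a r, ω.g Θ =
    parafermionOn D a Θ (r.side .E) - parafermionOn D a Θ (r.side .W) -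
      Complex.exp ((Θ r.1 : ℝ) * Complex.I) * (parafermionOn D a Θ (r.side .S) - parafermionOn D a Θ (r.side .N)) := by
  rw [Fintype.sum_sigma]
  simp only [ΩG.g]
  have hu : (Finset.univ : Finset Side) = {Side.W, Side.E, Side.S, Side.N} := by decide
  rw [hu, Finset.sum_insert (by decide), Finset.sum_insert (by decide), Finset.sum_insert (by decide),
    Finset.sum_singleton]
  simp only [← Finset.mul_sum]
  rw [← parafermionOn, ← parafermionOn, ← parafermionOn, ← parafermionOn]
  simp only [crCoef]
  ring

end ΩG

/-- **Lemma 2.1 (CR) at ONE rhombus of a general finite face domain, for a non-interior root that is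
unwound at that rhombus**: `F(z_E) − F(z_W) = e^{iθ_r}(F(z_S) − F(z_N))` for `F = parafermionOn D a Θ`.
[cite: GlazmanManolescu2019, Lemma 2.1] -/
theorem lem21_of_unwoundAt [Finite D] (hU : UnwoundAt D a r) (Θ : ℤ → ℝ)
    (hΘ : ∀ k, Θ k ∈ Set.Icc (π / 3) (2 * π / 3)) (hr : RootedFace D a r) :
    parafermionOn D a Θ (r.side .E) - parafermionOn D a Θ (r.side .W) =
      Complex.exp ((Θ r.1 : ℝ) * Complex.I) * (parafermionOn D a Θ (r.side .S) - parafermionOn D a Θ (r.side .N)) := by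
  have key := ΩG.sum_g_eq_zero_at (D := D) (a := a) (r := r) Θ hr hU hΘ
  rw [Fintype.sum_sigma] at key
  simp only [ΩG.g] at key
  have hu : (Finset.univ : Finset Side) = {Side.W, Side.E, Side.S, Side.N} := by decide
  rw [hu, Finset.sum_insert (by decide), Finset.sum_insert (by decide), Finset.sum_insert (by decide),
    Finset.sum_singleton] at key
  simp only [← Finset.mul_sum] at key
  rw [← parafermionOn, ← parafermionOn, ← parafermionOn, ← parafermionOn] at key
  simp only [crCoef] at key
  linear_combination key

/-- **The square-frame relation at one unwound rhombus** (constant angle). [cite: GlazmanManolescu2019, Lemma 2.1, eq. (2.2) (CR)] -/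
theorem sqRelation_const_of_unwoundAt [Finite D] (hU : UnwoundAt D a r) {θ : ℝ}
    (hθ : θ ∈ Set.Icc (π / 3) (2 * π / 3)) (hr : RootedFace D a r) :
    sqParafermionOn D a (fun _ => θ) (r.side .E) - sqParafermionOn D a (fun _ => θ) (r.side .W) =
      Complex.exp (((3 / 8 * θ + 5 * π / 16 : ℝ) : ℂ) * Complex.I) *
        (sqParafermionOn D a (fun _ => θ) (r.side .S) - sqParafermionOn D a (fun _ => θ) (r.side .N)) :=
  sqRelation_of_lem21 (fun _ => θ) r (lem21_of_unwoundAt hU (fun _ => θ) (fun _ => hθ) hr)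

end Literature.Probability.RandomPlanarGeometry.SAW.YangBaxter

/-! ## In the `PlaquetteWalk` vocabulary of the barrier catalogue -/

namespace Literature.Barriers.CriticalPhenomena.PlaquetteWalk

open Literature.Probability.RandomPlanarGeometry.SAW.YangBaxter
open Literature.Probability.RandomPlanarGeometry.SAW.YangBaxter.MidEdge

/-- ★★★ **The Yang–Baxter vertex identity at an unwound plaquette, for ANY boundary root** (outer or hole):
for every `θ ∈ [π/3, 2π/3]`, every finite face list `Dl`, every non-interior mid-edge `a` and every
plaquette `f₀ ∈ Dl` at which no excursion polygon of a walk from `a` winds around `a`,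
`Σ_s c_s F(f₀.side s) = 0` for the printed weights and the coefficients `(1, r(θ), −1, −r(θ))`. (For an outer
root every plaquette is unwound: this is the tree's C-B2 `vertexFunctional_printed_eq_zero`.)
[cite: GlazmanManolescu2019, Lemma 2.1, eq. (2.2) (CR)] [cite: DuminilCopinSmirnov2012, proof of Lemma 1] -/
theorem vertexFunctional_printed_eq_zero_of_unwoundAt {θ : ℝ} (hθ : θ ∈ Set.Icc (π / 3) (2 * π / 3))
    (Dl : List Face) (a : MidEdge) (ha : ¬(a.faces.1 ∈ dom Dl ∧ a.faces.2 ∈ dom Dl)) (f₀ : Face) (hf : f₀ ∈ Dl)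
    (hU : UnwoundAt (dom Dl) a f₀) :
    vertexFunctional (printedWeights θ) tFiveEighths (ybCoeff θ) Dl a f₀ = 0 := by
  have key := sqRelation_const_of_unwoundAt hU hθ ⟨(show f₀ ∈ dom Dl from hf), ha⟩
  have hr : Complex.exp (((3 / 8 * θ + 5 * π / 16 : ℝ) : ℂ) * Complex.I) = ybRatio θ := by
    unfold ybRatio; congr 1; push_cast; ring
  rw [hr] at key
  unfold vertexFunctional
  simp only [Fin.sum_univ_four, gmObservable_printed_eq]
  have e0 : slotSide f₀ 0 = f₀.side .E := rfl
  have e1 : slotSide f₀ 1 = f₀.side .N := rfl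
  have e2 : slotSide f₀ 2 = f₀.side .W := rfl
  have e3 : slotSide f₀ 3 = f₀.side .S := rfl
  have c0 : ybCoeff θ 0 = 1 := rfl
  have c1 : ybCoeff θ 1 = ybRatio θ := rfl
  have c2 : ybCoeff θ 2 = -1 := rfl
  have c3 : ybCoeff θ 3 = -ybRatio θ := rfl
  rw [e0, e1, e2, e3, c0, c1, c2, c3]
  linear_combination key

/-- **The catalogue's vertex functional is the Lemma-2.1 defect up to the root phase**:
`VF_D(a, f₀) = e^{−i(5/8)κ(a)} · (F(z_E) − F(z_W) − e^{iθ}(F(z_S) − F(z_N)))`, `F = parafermionOn (dom Dl) a θ`,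
`κ(a)` the slant potential of the root (`0` on vertical mid-edges, `θ − π/2` on slanted ones).
[cite: GlazmanManolescu2019, §2.1, Lemma 2.1 eq. (CR)] -/
theorem vertexFunctional_printed_eq_phase_mul_lem21Defect (θ : ℝ) (Dl : List Face) (a : MidEdge) (f₀ : Face) :
    vertexFunctional (printedWeights θ) tFiveEighths (ybCoeff θ) Dl a f₀ =
      Complex.exp (((-(5 / 8 * slantPot (fun _ => θ) a) : ℝ) : ℂ) * Complex.I) *
        (parafermionOn (dom Dl) a (fun _ => θ) (f₀.side .E) - parafermionOn (dom Dl) a (fun _ => θ) (f₀.side .W) -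
          Complex.exp ((θ : ℂ) * Complex.I) *
            (parafermionOn (dom Dl) a (fun _ => θ) (f₀.side .S) - parafermionOn (dom Dl) a (fun _ => θ) (f₀.side .N))) := by
  unfold vertexFunctional
  simp only [Fin.sum_univ_four, gmObservable_printed_eq]
  have e0 : slotSide f₀ 0 = f₀.side .E := rfl
  have e1 : slotSide f₀ 1 = f₀.side .N := rfl
  have e2 : slotSide f₀ 2 = f₀.side .W := rfl
  have e3 : slotSide f₀ 3 = f₀.side .S := rfl
  have c0 : ybCoeff θ 0 = 1 := rfl
  have c1 : ybCoeff θ 1 = ybRatio θ := rfl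
  have c2 : ybCoeff θ 2 = -1 := rfl
  have c3 : ybCoeff θ 3 = -ybRatio θ := rfl
  rw [e0, e1, e2, e3, c0, c1, c2, c3]
  simp only [sqParafermionOn_eq, slantPot_sideW, slantPot_sideE, slantPot_sideS, slantPot_sideN]
  have hsplit : Complex.exp (((5 / 8 * (θ - π / 2 - slantPot (fun _ => θ) a) : ℝ) : ℂ) * Complex.I) =
      Complex.exp (((5 / 8 * (θ - π / 2) : ℝ) : ℂ) * Complex.I) *
        Complex.exp (((-(5 / 8 * slantPot (fun _ => θ) a) : ℝ) : ℂ) * Complex.I) := by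
    rw [← Complex.exp_add]; congr 1; push_cast; ring
  have h0 : Complex.exp (((5 / 8 * (0 - slantPot (fun _ => θ) a) : ℝ) : ℂ) * Complex.I) =
      Complex.exp (((-(5 / 8 * slantPot (fun _ => θ) a) : ℝ) : ℂ) * Complex.I) := by
    congr 1; push_cast; ring
  have hr : ybRatio θ * Complex.exp (((5 / 8 * (θ - π / 2) : ℝ) : ℂ) * Complex.I) = Complex.exp ((θ : ℂ) * Complex.I) := by
    unfold ybRatio; rw [← Complex.exp_add]; congr 1; push_cast; ring
  rw [hsplit, h0]
  linear_combination (parafermionOn (dom Dl) a (fun _ => θ) (f₀.side .N) - parafermionOn (dom Dl) a (fun _ => θ) (f₀.side .S)) *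
    Complex.exp (((-(5 / 8 * slantPot (fun _ => θ) a) : ℝ) : ℂ) * Complex.I) * hr

open Classical in
/-- ★★★ **DEFECT LOCALISATION for the Yang–Baxter vertex identity at an arbitrary boundary root**: for every
`θ ∈ [π/3, 2π/3]`, every finite face list, every non-interior root `a` (outer OR hole) and every plaquette
`f₀ ∈ Dl`, the vertex functional at `f₀` equals the root phase times the grouped sum over the WOUND excursions
at `f₀` — the walks of class `B2a` at `f₀` whose excursion polygon (or that of the reversed companion) winds
around the root. No wound excursion ⇒ the identity holds (`…_of_unwoundAt`); the lane's conjecture C-B5 is that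
the wound sum never vanishes when it is non-empty. [cite: GlazmanManolescu2019, Lemma 2.1 (statement, "in the form given in [Gl]"); Glazman2015WeightedSAW, Lemma 3.1 (proof)] [cite: DuminilCopinSmirnov2012, proof of Lemma 1] -/
theorem vertexFunctional_printed_eq_wound_sum {θ : ℝ} (hθ : θ ∈ Set.Icc (π / 3) (2 * π / 3))
    (Dl : List Face) (a : MidEdge) (ha : ¬(a.faces.1 ∈ dom Dl ∧ a.faces.2 ∈ dom Dl)) (f₀ : Face) (hf : f₀ ∈ Dl) :
    vertexFunctional (printedWeights θ) tFiveEighths (ybCoeff θ) Dl a f₀ =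
      Complex.exp (((-(5 / 8 * slantPot (fun _ => θ) a) : ℝ) : ℂ) * Complex.I) *
        ∑ ω ∈ (ΩG.setB2a (dom Dl) a f₀).filter (fun ω => ¬ω.Unwound ⟨hf, ha⟩), ω.G (fun _ => θ) ⟨hf, ha⟩ := by
  rw [vertexFunctional_printed_eq_phase_mul_lem21Defect, ← ΩG.sum_g_eq_lem21Defect,
    ΩG.sum_g_eq_sum_wound (fun _ => θ) ⟨hf, ha⟩ (fun _ => hθ)]

/-- ★★ **The identity at a plaquette admitting no excursion** (no walk from `a` of class `B2a` at `f₀` — for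
instance a plaquette with too few sides leading into the domain), for any non-interior root, outer or hole.
[cite: GlazmanManolescu2019, Lemma 2.1] -/
theorem vertexFunctional_printed_eq_zero_of_no_excursion {θ : ℝ} (hθ : θ ∈ Set.Icc (π / 3) (2 * π / 3))
    (Dl : List Face) (a : MidEdge) (ha : ¬(a.faces.1 ∈ dom Dl ∧ a.faces.2 ∈ dom Dl)) (f₀ : Face) (hf : f₀ ∈ Dl)
    (hno : ∀ ω : ΩG (dom Dl) a f₀, ¬ω.IsB2a) :
    vertexFunctional (printedWeights θ) tFiveEighths (ybCoeff θ) Dl a f₀ = 0 :=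
  vertexFunctional_printed_eq_zero_of_unwoundAt hθ Dl a ha f₀ hf (unwoundAt_of_no_excursion hno)

/-- ★★ **The identity at every plaquette with at most two doors, for ANY boundary root** (outer or hole): if at
most two sides of `f₀ ∈ Dl` are interior edges of the domain or the root itself (corner plaquettes, dead ends of
corridors, plaquettes flanked by holes), the Yang–Baxter vertex functional from `a` vanishes at `f₀`, for every
`θ ∈ [π/3, 2π/3]`. [cite: GlazmanManolescu2019, Lemma 2.1] [cite: DuminilCopinSmirnov2012, proof of Lemma 1] -/
theorem vertexFunctional_printed_eq_zero_of_two_doors {θ : ℝ} (hθ : θ ∈ Set.Icc (π / 3) (2 * π / 3))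
    (Dl : List Face) (a : MidEdge) (ha : ¬(a.faces.1 ∈ dom Dl ∧ a.faces.2 ∈ dom Dl)) (f₀ : Face) (hf : f₀ ∈ Dl)
    (s₁ s₂ : Side)
    (hdoors : ∀ s : Side,
      (((f₀.side s).faces.1 ∈ dom Dl ∧ (f₀.side s).faces.2 ∈ dom Dl) ∨ f₀.side s = a) → s = s₁ ∨ s = s₂) :
    vertexFunctional (printedWeights θ) tFiveEighths (ybCoeff θ) Dl a f₀ = 0 :=
  vertexFunctional_printed_eq_zero_of_no_excursion hθ Dl a ha f₀ hf
    (ΩG.not_isB2a_of_two_doors ⟨(show f₀ ∈ dom Dl from hf), ha⟩ s₁ s₂ hdoors)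

/-- The lane's `ring8x = 4 × 3 ∖ {(1,1)}` with the THICK hole root `a` = W side of `(2,1)`: the corner plaquette
`(3, 0)` has two doors (W and N), so the identity holds there for every `θ` — one of the seven vanishing
plaquettes of the lane's table (HOME `code/step0/g14/thick/`). [cite: GlazmanManolescu2019, Lemma 2.1] -/
example {θ : ℝ} (hθ : θ ∈ Set.Icc (π / 3) (2 * π / 3)) :
    vertexFunctional (printedWeights θ) tFiveEighths (ybCoeff θ)
      [((0 : ℤ), (0 : ℤ)), (1, 0), (2, 0), (3, 0), (0, 1), (2, 1), (3, 1), (0, 2), (1, 2), (2, 2), (3, 2)]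
      (Face.side (2, 1) .W) (3, 0) = 0 := by
  refine vertexFunctional_printed_eq_zero_of_two_doors hθ _ _ ?_ (3, 0) (by decide) .W .N ?_
  · simp [dom, Face.side, MidEdge.faces]
  · intro s hs
    rcases s with _ | _ | _ | _
    · exact Or.inl rfl
    · simp [dom, Face.side, MidEdge.faces] at hs
    · simp [dom, Face.side, MidEdge.faces] at hs
    · exact Or.inr rfl

end Literature.Barriers.CriticalPhenomena.PlaquetteWalk

/-! ## Rider (Part 6a): the grouped sum in CLOSED FORM — signed class terms, and the root's own plaquette

For every class-`B2a` walk the group `G ω + G (rev ω)` equals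
`extWeight · phase(WP) · 2i·sin((5/8)(WE − excursionWinding)) · backBracket(θ_r; z₀, z₁, z₂, z₃)`, where
`backBracket` is the backward half of the bracket at the tabulated winding — an explicit function of `θ_r` and
the four sides — and `WE − excursionWinding ∈ 4π·ℤ`, so the sine is `0` or `±1` (the SIGN of the group).
Summing, `Σ_{B2a} G = i · Σ_{B2a} classTerm`, and at the ROOT'S OWN PLAQUETTE (`r = w`, `a = w.side σ`) every
prefix is trivial (`WP = 0`, `z₀ = σ`): the vertex functional there is the root phase times `i` times a signed
sum of non-negative real masses `extWeight` along at most six explicit directions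
`backBracket(θ; σ, exit, return, fourth)`. In particular the vertex identity HOLDS at the root's own plaquette
whenever `B2a(w)` is empty («pocket» hole roots: `w` with a single side into the domain, or on a dead-end
corridor — e.g. by the parent file's `vertexFunctional_printed_eq_zero_of_two_doors`), so «hole root ⇒
`VF_D(a,w) ≠ 0`» is FALSE as a blanket statement (the lane's question (Q2) as first written, refuted on exact
data, HOME `FINDING-YB-ENCIRCLING-CRITERION.md` status block 2). The statement these identities address is the
WOUND-WALK DICHOTOMY (Q2′) «`VF_D(w.side σ, w) = 0` ↔ no wound class-`B2a` walk at `w`»: `⟸` is the parent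
file's `vertexFunctional_printed_eq_wound_sum`; `⟹` is thereby reduced to the sign pattern of the masses (a
lattice Jordan-curve statement with orientation, OPEN) and a half-plane property of these directions (Parts 6b/6c
below).
-/

namespace Literature.Probability.RandomPlanarGeometry.SAW.YangBaxter

open Real Complex

/-- **The backward half of the bracket at the tabulated winding**: the two members of the group of an
excursion `z₁ → z₂` (first side `z₀`, fourth side `z₃`) traversed backwards, evaluated at the winding
`excursionWinding θ z₀ z₁ z₂`. [cite: GlazmanManolescu2019, Lemma 2.1 (statement, "in the form given in [Gl]"); Glazman2015WeightedSAW, Lemma 3.1 (proof)] -/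
def backBracket (θ : ℝ) (z₀ z₁ z₂ z₃ : Side) : ℂ :=
  crCoef θ z₁ * (arcWeight θ z₀ z₂ : ℂ) * phase (arcTurn θ z₀ z₂ - excursionWinding θ z₀ z₁ z₂) +
    crCoef θ z₃ * (pairWeight θ z₀ z₂ z₁ z₃ : ℂ) *
      phase (arcTurn θ z₀ z₂ - excursionWinding θ z₀ z₁ z₂ + arcTurn θ z₁ z₃)

/-- The bracket one real shift `Y` further: the forward half turns by `e^{−i5Y/8}`, the backward half by
`e^{+i5Y/8}`. [folklore] -/
private theorem bracket_add_shift (θ : ℝ) (z₀ z₁ z₂ z₃ : Side) (X Y : ℝ) :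
    bracket θ z₀ z₁ z₂ z₃ (X + Y) =
      Complex.exp ((((-(5 / 8) * Y : ℝ)) : ℂ) * Complex.I) *
          (crCoef θ z₂ * (arcWeight θ z₀ z₁ : ℂ) * phase (arcTurn θ z₀ z₁ + X) +
            crCoef θ z₃ * (pairWeight θ z₀ z₁ z₂ z₃ : ℂ) * phase (arcTurn θ z₀ z₁ + X + arcTurn θ z₂ z₃)) +
        Complex.exp ((((5 / 8) * Y : ℝ) : ℂ) * Complex.I) *
          (crCoef θ z₁ * (arcWeight θ z₀ z₂ : ℂ) * phase (arcTurn θ z₀ z₂ - X) +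
            crCoef θ z₃ * (pairWeight θ z₀ z₂ z₁ z₃ : ℂ) * phase (arcTurn θ z₀ z₂ - X + arcTurn θ z₁ z₃)) := by
  have hp : ∀ W : ℝ, phase (W + Y) = Complex.exp ((((-(5 / 8) * Y : ℝ)) : ℂ) * Complex.I) * phase W := by
    intro W; unfold phase; rw [← Complex.exp_add]; congr 1; push_cast; ring
  have hm : ∀ W : ℝ, phase (W - Y) = Complex.exp ((((5 / 8) * Y : ℝ) : ℂ) * Complex.I) * phase W := by
    intro W; unfold phase; rw [← Complex.exp_add]; congr 1; push_cast; ring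
  unfold bracket
  rw [show arcTurn θ z₀ z₁ + (X + Y) = (arcTurn θ z₀ z₁ + X) + Y by ring,
    show arcTurn θ z₀ z₁ + X + Y + arcTurn θ z₂ z₃ = (arcTurn θ z₀ z₁ + X + arcTurn θ z₂ z₃) + Y by ring,
    show arcTurn θ z₀ z₂ - (X + Y) = (arcTurn θ z₀ z₂ - X) - Y by ring,
    show arcTurn θ z₀ z₂ - X - Y + arcTurn θ z₁ z₃ = (arcTurn θ z₀ z₂ - X + arcTurn θ z₁ z₃) - Y by ring,
    hp, hp, hm, hm]
  ring

/-- **The bracket at a shifted tabulated winding**: `bracket(excursionWinding + Y) = 2i·sin(5Y/8)·backBracket`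
(the forward and backward halves cancel at `Y = 0` by the second local relation `groupTwo_gen`, and a shift
turns them oppositely). [cite: GlazmanManolescu2019, Lemma 2.1 (proof: [Gl], Lemma 3.1)] -/
theorem bracket_excursionWinding_add (θ : ℝ) {z₀ z₁ z₂ z₃ : Side} (h01 : z₀ ≠ z₁) (h02 : z₀ ≠ z₂)
    (h03 : z₀ ≠ z₃) (h12 : z₁ ≠ z₂) (h13 : z₁ ≠ z₃) (h23 : z₂ ≠ z₃) (Y : ℝ) :
    bracket θ z₀ z₁ z₂ z₃ (excursionWinding θ z₀ z₁ z₂ + Y) =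
      2 * Complex.I * (Real.sin (5 / 8 * Y) : ℂ) * backBracket θ z₀ z₁ z₂ z₃ := by
  have h0 := groupTwo_gen θ z₀ z₁ z₂ z₃ h01 h02 h03 h12 h13 h23
  unfold bracket at h0
  rw [bracket_add_shift]
  unfold backBracket
  set X := excursionWinding θ z₀ z₁ z₂
  set F := crCoef θ z₂ * (arcWeight θ z₀ z₁ : ℂ) * phase (arcTurn θ z₀ z₁ + X) +
    crCoef θ z₃ * (pairWeight θ z₀ z₁ z₂ z₃ : ℂ) * phase (arcTurn θ z₀ z₁ + X + arcTurn θ z₂ z₃)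
  set B := crCoef θ z₁ * (arcWeight θ z₀ z₂ : ℂ) * phase (arcTurn θ z₀ z₂ - X) +
    crCoef θ z₃ * (pairWeight θ z₀ z₂ z₁ z₃ : ℂ) * phase (arcTurn θ z₀ z₂ - X + arcTurn θ z₁ z₃)
  have hF : F = -B := by linear_combination h0
  have h2 := Complex.two_sin (((5 / 8 * Y : ℝ)) : ℂ)
  have eneg : Complex.exp ((((-(5 / 8) * Y : ℝ)) : ℂ) * Complex.I) =
      Complex.exp (-((5 / 8 * Y : ℝ) : ℂ) * Complex.I) := by
    congr 1; push_cast; ring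
  have hsin : 2 * Complex.I * Complex.sin (((5 / 8 * Y : ℝ)) : ℂ) =
      Complex.exp ((((5 / 8) * Y : ℝ) : ℂ) * Complex.I) - Complex.exp (-((5 / 8 * Y : ℝ) : ℂ) * Complex.I) := by
    linear_combination Complex.I * h2 +
      (Complex.exp (-((5 / 8 * Y : ℝ) : ℂ) * Complex.I) - Complex.exp ((((5 / 8) * Y : ℝ) : ℂ) * Complex.I)) *
        Complex.I_sq
  rw [hF, Complex.ofReal_sin, eneg]
  linear_combination (-B) * hsin

/-- The SIGN of a group: `sin((5/8)·4πm) ∈ {0, 1, −1}` for every integer `m`. [folklore] -/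
private theorem sin_five_eighths_four_pi_mul (m : ℤ) :
    Real.sin (5 / 8 * (4 * π * m)) = 0 ∨ Real.sin (5 / 8 * (4 * π * m)) = 1 ∨
      Real.sin (5 / 8 * (4 * π * m)) = -1 := by
  obtain ⟨k, hk | hk⟩ := Int.even_or_odd' m
  · left
    rw [hk, show (5 : ℝ) / 8 * (4 * π * ((2 * k : ℤ) : ℝ)) = ((5 * k : ℤ) : ℝ) * π by push_cast; ring]
    exact Real.sin_int_mul_pi _
  · right
    have e : (5 : ℝ) / 8 * (4 * π * ((2 * k + 1 : ℤ) : ℝ)) = ((5 * k + 2 : ℤ) : ℝ) * π + π / 2 := by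
      push_cast; ring
    rw [hk, e, Real.sin_add_pi_div_two]
    have hs : Real.sin (((5 * k + 2 : ℤ) : ℝ) * π) = 0 := Real.sin_int_mul_pi _
    have hc := Real.sin_sq_add_cos_sq (((5 * k + 2 : ℤ) : ℝ) * π)
    rw [hs] at hc
    have hprod : (Real.cos (((5 * k + 2 : ℤ) : ℝ) * π) - 1) * (Real.cos (((5 * k + 2 : ℤ) : ℝ) * π) + 1) = 0 := by
      nlinarith
    rcases mul_eq_zero.1 hprod with h1 | h1
    · left; linarith
    · right; linarith

namespace ΩG

variable {D : Set Face} {a : MidEdge} {r : Face} (ω : ΩG D a r) (Θ : ℤ → ℝ)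

/-- **Winding quantisation**: `WE − excursionWinding ∈ 4π·ℤ` for every class-`B2a` walk, in either orientation
(canonical: `+2·AJ`, else `−2·AJ_rev`, and `AJ ∈ 2πℤ`). [cite: GlazmanManolescu2019, Lemma 2.1 (statement, "in the form given in [Gl]"); Glazman2015WeightedSAW, Lemma 3.1 (proof)] -/
theorem WE_sub_excursionWinding_mem (hr : RootedFace D a r) (h : ω.IsB2a) :
    ∃ m : ℤ, ω.WE Θ - excursionWinding (Θ r.1) ω.2.firstSideG (ω.2.exitSideG hr (ω.fh_lt h)) ω.1 = 4 * π * m := by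
  have hd := ω.2.sides_distinctG hr h.1
  rw [ω.returnSide_of_isB2a h] at hd
  rcases canon_or_swap hd.1.symm hd.2.1.symm hd.2.2.symm with hc | hc
  · have hc' : Canon ω.2.firstSideG (ω.z1 hr h) ω.1 := by unfold ΩG.z1; exact hc
    obtain ⟨n, hn⟩ := AJ_eq_int_mul_two_pi (ω := ω) (hr := hr) h (toC (midPt a))
    refine ⟨n, ?_⟩
    rw [ω.WE_eq_excursionWinding_add_two_AJ hr hc' Θ, hn]; ring
  · have h'' := ω.rev_isB2a hr h
    have hc' : Canon (ω.rev hr).2.firstSideG ((ω.rev hr).z1 hr h'') (ω.rev hr).1 := by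
      unfold ΩG.z1; rw [ω.rev_firstSide hr h, ω.rev_exitSide hr h, ω.rev_fst hr h]; exact hc
    obtain ⟨n, hn⟩ := AJ_eq_int_mul_two_pi (ω := ω.rev hr) (hr := hr) h'' (toC (midPt a))
    refine ⟨-n, ?_⟩
    rw [ω.WE_eq_excursionWinding_sub_two_AJ_rev hr (h := h) hc' Θ, hn]; push_cast; ring

/-- The sign of the group of a class-`B2a` walk is `0` (unwound) or `±1`. [cite: GlazmanManolescu2019, Lemma 2.1 (statement, "in the form given in [Gl]"); Glazman2015WeightedSAW, Lemma 3.1 (proof)] -/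
theorem sin_WE_sub_excursionWinding (hr : RootedFace D a r) (h : ω.IsB2a) :
    Real.sin (5 / 8 * (ω.WE Θ - excursionWinding (Θ r.1) ω.2.firstSideG (ω.2.exitSideG hr (ω.fh_lt h)) ω.1)) = 0 ∨
      Real.sin (5 / 8 * (ω.WE Θ - excursionWinding (Θ r.1) ω.2.firstSideG (ω.2.exitSideG hr (ω.fh_lt h)) ω.1)) = 1 ∨
        Real.sin (5 / 8 * (ω.WE Θ - excursionWinding (Θ r.1) ω.2.firstSideG (ω.2.exitSideG hr (ω.fh_lt h)) ω.1)) = -1 := by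
  obtain ⟨m, hm⟩ := ω.WE_sub_excursionWinding_mem Θ hr h
  rw [hm]
  exact sin_five_eighths_four_pi_mul m

open Classical in
/-- **The signed class term of a walk**: for a class-`B2a` walk,
`extWeight · phase(WP) · sin((5/8)(WE − excursionWinding)) · backBracket(θ_r; z₀, z₁, z₂, z₃)` — a non-negative
real mass, the prefix phase, a sign `∈ {0, ±1}`, and one of finitely many explicit directions; `0` otherwise.
[cite: GlazmanManolescu2019, Lemma 2.1 (statement, "in the form given in [Gl]"); Glazman2015WeightedSAW, Lemma 3.1 (proof)] -/
noncomputable def classTerm (hr : RootedFace D a r) : ℂ :=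
  if h : ω.IsB2a then
    (ω.2.extWeight Θ r : ℂ) * phase (ω.WP Θ) *
      (Real.sin (5 / 8 * (ω.WE Θ -
          excursionWinding (Θ r.1) ω.2.firstSideG (ω.2.exitSideG hr (ω.fh_lt h)) ω.1)) : ℂ) *
        backBracket (Θ r.1) ω.2.firstSideG (ω.2.exitSideG hr (ω.fh_lt h)) ω.1 (ω.z₃ hr h)
  else 0

/-- ★★ **The group of EVERY class-`B2a` walk is `2i` times its signed class term** (no hypothesis).
[cite: GlazmanManolescu2019, Lemma 2.1 (statement, "in the form given in [Gl]"); Glazman2015WeightedSAW, Lemma 3.1 (proof)] -/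
theorem G_add_G_rev_eq_classTerm (hr : RootedFace D a r) (h : ω.IsB2a) :
    ω.G Θ hr + (ω.rev hr).G Θ hr = 2 * Complex.I * ω.classTerm Θ hr := by
  have hd := ω.2.sides_distinctG hr h.1
  rw [ω.returnSide_of_isB2a h] at hd
  have h3 := ω.z₃_spec hr h
  rw [ω.G_add_G_rev_eq_bracket Θ hr h, classTerm, dif_pos h]
  set X := excursionWinding (Θ r.1) ω.2.firstSideG (ω.2.exitSideG hr (ω.fh_lt h)) ω.1 with hX
  have e : bracket (Θ r.1) ω.2.firstSideG (ω.2.exitSideG hr (ω.fh_lt h)) ω.1 (ω.z₃ hr h) (ω.WE Θ) =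
      bracket (Θ r.1) ω.2.firstSideG (ω.2.exitSideG hr (ω.fh_lt h)) ω.1 (ω.z₃ hr h) (X + (ω.WE Θ - X)) := by
    congr 1; ring
  rw [e, hX, bracket_excursionWinding_add (Θ r.1) (z₁ := ω.2.exitSideG hr (ω.fh_lt h)) (z₃ := ω.z₃ hr h)
    hd.1.symm hd.2.1.symm h3.1.symm hd.2.2.symm h3.2.1.symm h3.2.2.symm]
  ring

variable [Finite D]

/-- Reversal re-indexes the class-`B2a` sum. [folklore] -/
private theorem sum_G_rev (hr : RootedFace D a r) :
    ∑ ω ∈ setB2a D a r, (ω.rev hr).G Θ hr = ∑ ω ∈ setB2a D a r, ω.G Θ hr := by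
  refine Finset.sum_nbij' (fun ω => ω.rev hr) (fun ω => ω.rev hr) ?_ ?_ ?_ ?_ ?_
  · intro ω hω
    simp only [setB2a, Finset.mem_filter, Finset.mem_univ, true_and] at hω ⊢
    exact ω.rev_isB2a hr hω
  · intro ω hω
    simp only [setB2a, Finset.mem_filter, Finset.mem_univ, true_and] at hω ⊢
    exact ω.rev_isB2a hr hω
  · intro ω hω
    simp only [setB2a, Finset.mem_filter, Finset.mem_univ, true_and] at hω
    exact ω.rev_rev hr hω
  · intro ω hω
    simp only [setB2a, Finset.mem_filter, Finset.mem_univ, true_and] at hω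
    exact ω.rev_rev hr hω
  · intro ω _; rfl

/-- ★★★ **The grouped sum in closed form**: `Σ_{B2a} G = i · Σ_{B2a} classTerm` — the Lemma-2.1 defect of ANY
root at ANY rhombus is `i` times a signed sum of non-negative masses along explicit directions turned by the
prefix phases. [cite: GlazmanManolescu2019, Lemma 2.1 (statement, "in the form given in [Gl]"); Glazman2015WeightedSAW, Lemma 3.1 (proof)] -/
theorem sum_G_eq_I_mul_sum_classTerm (hr : RootedFace D a r) :
    ∑ ω ∈ setB2a D a r, ω.G Θ hr = Complex.I * ∑ ω ∈ setB2a D a r, ω.classTerm Θ hr := by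
  have hsum : ∑ ω ∈ setB2a D a r, (ω.G Θ hr + (ω.rev hr).G Θ hr) =
      ∑ ω ∈ setB2a D a r, 2 * Complex.I * ω.classTerm Θ hr := by
    refine Finset.sum_congr rfl fun ω hω => ?_
    simp only [setB2a, Finset.mem_filter, Finset.mem_univ, true_and] at hω
    exact ω.G_add_G_rev_eq_classTerm Θ hr hω
  rw [Finset.sum_add_distrib, sum_G_rev, ← Finset.mul_sum] at hsum
  linear_combination (1 / 2 : ℂ) * hsum

/-- **All walks, grouped**: `Σ_ω g = Σ_{B2a} G` (classes `A`/`B1` cancel by the first local relation, `B2b`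
joins the groups). [cite: GlazmanManolescu2019, Lemma 2.1 (statement, "in the form given in [Gl]"); Glazman2015WeightedSAW, Lemma 3.1 (proof)] -/
theorem sum_g_eq_sum_G (hr : RootedFace D a r) (hΘ : ∀ k, Θ k ∈ Set.Icc (π / 3) (2 * π / 3)) :
    ∑ ω : ΩG D a r, ω.g Θ = ∑ ω ∈ setB2a D a r, ω.G Θ hr := by
  rw [sum_split, add_assoc, sum_A_add_sum_B1 Θ hr hΘ, zero_add, sum_B2b hr, ← Finset.sum_add_distrib]
  rfl

/-- ★★★ **The Lemma-2.1 defect in closed form**: `Σ_ω g = i · Σ_{B2a} classTerm`. [cite: GlazmanManolescu2019, Lemma 2.1 (statement, "in the form given in [Gl]"); Glazman2015WeightedSAW, Lemma 3.1 (proof)] -/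
theorem sum_g_eq_I_mul_sum_classTerm (hr : RootedFace D a r) (hΘ : ∀ k, Θ k ∈ Set.Icc (π / 3) (2 * π / 3)) :
    ∑ ω : ΩG D a r, ω.g Θ = Complex.I * ∑ ω ∈ setB2a D a r, ω.classTerm Θ hr := by
  rw [sum_g_eq_sum_G Θ hr hΘ, sum_G_eq_I_mul_sum_classTerm]

end ΩG

/-! ### The root's own plaquette -/

namespace YBWalk

/-- At the root's own plaquette the first hit is immediate. [folklore] -/
private theorem firstHitG_root {D : Set Face} {w : Face} {σ s : Side} (γ : YBWalk D (w.side σ) (w.side s)) :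
    γ.firstHitG = 0 := by
  apply Nat.le_zero.1
  unfold YBWalk.firstHitG
  apply Finset.min'_le
  rw [mem_hitIdx]
  exact ⟨Nat.zero_le _, σ, γ.nth_zero⟩

end YBWalk

namespace ΩG

variable {D : Set Face} {w : Face} {σ : Side} (ω : ΩG D (w.side σ) w) (Θ : ℤ → ℝ)

/-- At the root's own plaquette the prefix is empty: `WP = 0` (the walk starts on `∂w`).
[cite: GlazmanManolescu2019, Lemma 2.1 (statement, "in the form given in [Gl]"); Glazman2015WeightedSAW, Lemma 3.1 (proof)] -/
theorem WP_root : ω.WP Θ = 0 := by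
  unfold ΩG.WP; rw [ω.2.firstHitG_root]; simp

/-- At the root's own plaquette the first side crossed is the root side `σ` (the walk starts there).
[cite: GlazmanManolescu2019, Lemma 2.1 (statement, "in the form given in [Gl]"); Glazman2015WeightedSAW, Lemma 3.1 (proof)] -/
theorem firstSideG_root : ω.2.firstSideG = σ := by
  have h := ω.2.nth_firstHitG
  rw [ω.2.firstHitG_root, YBWalk.nth_zero] at h
  exact (w.side_injective h).symm

/-- **The signed class term at the root's own plaquette**: no prefix phase, first side `σ`.
[cite: GlazmanManolescu2019, Lemma 2.1 (statement, "in the form given in [Gl]"); Glazman2015WeightedSAW, Lemma 3.1 (proof)] -/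
theorem classTerm_root (hr : RootedFace D (w.side σ) w) (h : ω.IsB2a) :
    ω.classTerm Θ hr = (ω.2.extWeight Θ w : ℂ) *
      (Real.sin (5 / 8 * (ω.WE Θ - excursionWinding (Θ w.1) σ (ω.2.exitSideG hr (ω.fh_lt h)) ω.1)) : ℂ) *
        backBracket (Θ w.1) σ (ω.2.exitSideG hr (ω.fh_lt h)) ω.1 (ω.z₃ hr h) := by
  have h0 : phase 0 = 1 := by unfold phase; simp
  rw [classTerm, dif_pos h, ω.WP_root, ω.firstSideG_root, h0, mul_one]

end ΩG

end Literature.Probability.RandomPlanarGeometry.SAW.YangBaxter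

namespace Literature.Barriers.CriticalPhenomena.PlaquetteWalk

open Literature.Probability.RandomPlanarGeometry.SAW.YangBaxter

open Classical in
/-- ★★★ **ROOT-PLAQUETTE CLASS EXPANSION of the Yang–Baxter vertex functional.** For every `θ ∈ [π/3, 2π/3]`,
every finite face list, every plaquette `w` of the domain and side `σ` with the root `w.side σ` non-interior (`RootedFace`), the vertex
functional AT THE ROOT'S OWN PLAQUETTE is the root phase times `i` times the signed class sum
`Σ_{ω ∈ B2a(w)} extWeight(ω) · sin((5/8)(WE_ω − excursionWinding(θ; σ, exit ω, return ω))) ·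
backBracket(θ; σ, exit ω, return ω, fourth)` — non-negative masses, signs in `{0, ±1}`
(`ΩG.sin_WE_sub_excursionWinding`), at most six explicit directions. For isthmus roots Part 4 evaluates this
in closed form (`PlaquetteWalkIsthmusDichotomy`); when `B2a(w)` is empty («pocket» hole roots) the sum is empty
and the identity holds at `w`; in general the vanishing of this sum is the lane's wound-walk dichotomy (Q2′)
(«`= 0` ↔ no wound class-`B2a` walk at `w`», `⟹` open).
[cite: GlazmanManolescu2019, Lemma 2.1 (statement, "in the form given in [Gl]"); Glazman2015WeightedSAW, Lemma 3.1 (proof)] [cite: DuminilCopinSmirnov2012, proof of Lemma 1] -/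
theorem vertexFunctional_printed_root_plaquette_eq_class_sum {θ : ℝ} (hθ : θ ∈ Set.Icc (π / 3) (2 * π / 3))
    (Dl : List Face) (w : Face) (σ : Side) (hr : RootedFace (dom Dl) (w.side σ) w) :
    vertexFunctional (printedWeights θ) tFiveEighths (ybCoeff θ) Dl (w.side σ) w =
      Complex.exp (((-(5 / 8 * slantPot (fun _ => θ) (w.side σ)) : ℝ) : ℂ) * Complex.I) * Complex.I *
        ∑ ω ∈ ΩG.setB2a (dom Dl) (w.side σ) w,
          if h : ω.IsB2a then
            (ω.2.extWeight (fun _ => θ) w : ℂ) *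
              (Real.sin (5 / 8 * (ω.WE (fun _ => θ) -
                  excursionWinding θ σ (ω.2.exitSideG hr (ω.fh_lt h)) ω.1)) : ℂ) *
                backBracket θ σ (ω.2.exitSideG hr (ω.fh_lt h)) ω.1 (ω.z₃ hr h)
          else 0 := by
  rw [vertexFunctional_printed_eq_phase_mul_lem21Defect, ← ΩG.sum_g_eq_lem21Defect,
    ΩG.sum_g_eq_I_mul_sum_classTerm (fun _ => θ) hr (fun _ => hθ), mul_assoc]
  congr 2
  refine Finset.sum_congr rfl fun ω hω => ?_
  simp only [ΩG.setB2a, Finset.mem_filter, Finset.mem_univ, true_and] at hω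
  have hω' : ω.IsB2a := hω
  rw [dif_pos hω', ΩG.classTerm_root ω (fun _ => θ) hr hω']

/-- **A «pocket» hole root** (the witness refuting the lane's question (Q2) as first written, HOME
`FINDING-YB-ENCIRCLING-CRITERION.md`, status block 2): in `cupU = 5 × 4 ∖ {(1,1),(1,2),(2,2),(3,2),(3,1)}` the
plaquette `w = (2,1)` borders the (U-shaped) hole on its `W`, `N`, `E` sides and the domain only through `S`; the
root `a = w.side W` is a genuine hole root with a thick wall, yet `w` has just two doors (the root and `S`), so no
class-`B2a` walk exists at `w`, the class sum above is empty, and the Yang–Baxter vertex identity HOLDS at the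
root's own plaquette for every `θ ∈ [π/3, 2π/3]` (the parent file's `vertexFunctional_printed_eq_zero_of_two_doors`).
So «hole root ⇒ `VF_D(a,w) ≠ 0`» fails; the dichotomy addressed by this rider is «`VF_D(a,w) = 0` ↔ no wound
class-`B2a` walk at `w`». [cite: GlazmanManolescu2019, Lemma 2.1] -/
example {θ : ℝ} (hθ : θ ∈ Set.Icc (π / 3) (2 * π / 3)) :
    vertexFunctional (printedWeights θ) tFiveEighths (ybCoeff θ)
      [((0 : ℤ), (0 : ℤ)), (0, 1), (0, 2), (0, 3), (1, 0), (1, 3), (2, 0), (2, 1), (2, 3), (3, 0), (3, 3),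
        (4, 0), (4, 1), (4, 2), (4, 3)]
      (Face.side (2, 1) .W) (2, 1) = 0 := by
  refine vertexFunctional_printed_eq_zero_of_two_doors hθ _ _ ?_ (2, 1) (by decide) .W .S ?_
  · simp [dom, Face.side, MidEdge.faces]
  · intro s hs
    rcases s with _ | _ | _ | _
    · exact Or.inl rfl
    · simp [dom, Face.side, MidEdge.faces] at hs
    · exact Or.inr rfl
    · simp [dom, Face.side, MidEdge.faces] at hs

end Literature.Barriers.CriticalPhenomena.PlaquetteWalk

/-! ## Rider (Part 6b): the explicit class directions at the root side `W` (Lemma E, one root side of four)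

`|backBracket| = v(θ)` with affine phases: the three classes of the root side `W` in closed form, and the cone lemma
(all three signed directions within `π/8` of `−i·v(θ)`). The other three root sides are the images under the
symmetries of the rhombus and are left to the same script (HOME `DESIGN-next-3.md`, Lemma E table).
-/

namespace Literature.Probability.RandomPlanarGeometry.SAW.YangBaxter

open Real Complex

/-- `sin(5π/4) = −√2/2`. [folklore] -/
private theorem sin_five_pi_div_four : Real.sin (5 * π / 4) = -(√2 / 2) := by
  rw [show 5 * π / 4 = π / 4 + π by ring, Real.sin_add_pi, Real.sin_pi_div_four]

/-- `cos(5π/4) = −√2/2`. [folklore] -/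
private theorem cos_five_pi_div_four : Real.cos (5 * π / 4) = -(√2 / 2) := by
  rw [show 5 * π / 4 = π / 4 + π by ring, Real.cos_add_pi, Real.cos_pi_div_four]

/-- `w₁ = u₁·(cos(3θ/8) − sin(3θ/8))` — an identity between the weights of eq. (1). [cite: GlazmanManolescu2019, eq. (1)] -/
theorem weightW1_eq_weightU1_mul (θ : ℝ) : weightW1 θ = weightU1 θ * (Real.cos (3 * θ / 8) - Real.sin (3 * θ / 8)) := by
  unfold weightW1 weightU1
  rw [div_mul_eq_mul_div]
  congr 1
  rw [Real.sin_sub, sin_five_pi_div_four, cos_five_pi_div_four]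
  ring

/-- `v = √2·u₁·sin(3θ/8)` — an identity between the weights of eq. (1). [cite: GlazmanManolescu2019, eq. (1)] -/
theorem weightV_eq_sqrt_two_mul (θ : ℝ) : weightV θ = √2 * weightU1 θ * Real.sin (3 * θ / 8) := by
  unfold weightV weightU1
  rw [mul_div_assoc', div_mul_eq_mul_div]
  congr 1
  rw [sin_five_pi_div_four, Real.sin_neg]
  have h2 : √2 * √2 = 2 := Real.mul_self_sqrt (by norm_num)
  linear_combination ((1/2 : ℝ) * Real.sin (5 * π / 8 + 3 * θ / 8) * Real.sin (3 * θ / 8)) * h2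

/-- `e^{i5π/4} = −(√2/2)(1 + i)`. [folklore] -/
private theorem cexp_five_pi_div_four : Complex.exp (((5 * π / 4 : ℝ) : ℂ) * Complex.I) = ((-(√2 / 2) : ℝ) : ℂ) + ((-(√2 / 2) : ℝ) : ℂ) * Complex.I := by
  rw [Complex.exp_mul_I, ← Complex.ofReal_cos, ← Complex.ofReal_sin, cos_five_pi_div_four, sin_five_pi_div_four]

/-- `e^{iy} = cos y + i·sin y` with real casts. [folklore] -/
private theorem cexp_real_mul_I (y : ℝ) : Complex.exp ((y : ℂ) * Complex.I) = (Real.cos y : ℂ) + (Real.sin y : ℂ) * Complex.I := by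
  rw [Complex.exp_mul_I, ← Complex.ofReal_cos, ← Complex.ofReal_sin]

/-- ★ **Class `{S,N}` at the root side `W`** (the two sides adjacent to `W`): `backBracket(θ; W, S, N, E) = i·v(θ)`.
[cite: GlazmanManolescu2019, Lemma 2.1 (statement, "in the form given in [Gl]"); Glazman2015WeightedSAW, Lemma 3.1 (proof), eq. (1)] -/
theorem backBracket_W_S_N_E (θ : ℝ) : backBracket θ .W .S .N .E = Complex.I * (weightV θ : ℂ) := by
  unfold backBracket
  simp only [crCoef, arcWeight, pairWeight, localWeight, arcKind, arcTurn, excursionWinding, phase]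
  have e1 : Complex.exp ((θ : ℂ) * Complex.I) * Complex.exp (((-(5 / 8 * (θ - 2 * π)) : ℝ) : ℂ) * Complex.I) =
      ((Real.cos (3 * θ / 8) : ℂ) + (Real.sin (3 * θ / 8) : ℂ) * Complex.I) * (((-(√2 / 2) : ℝ) : ℂ) + ((-(√2 / 2) : ℝ) : ℂ) * Complex.I) := by
    rw [← Complex.exp_add, show (θ : ℂ) * Complex.I + ((-(5 / 8 * (θ - 2 * π)) : ℝ) : ℂ) * Complex.I =
      ((3 * θ / 8 : ℝ) : ℂ) * Complex.I + ((5 * π / 4 : ℝ) : ℂ) * Complex.I by push_cast; ring, Complex.exp_add,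
      cexp_real_mul_I, cexp_five_pi_div_four]
  have e2 : Complex.exp (((-(5 / 8 * (θ - 2 * π + -θ)) : ℝ) : ℂ) * Complex.I) = ((-(√2 / 2) : ℝ) : ℂ) + ((-(√2 / 2) : ℝ) : ℂ) * Complex.I := by
    rw [show ((-(5 / 8 * (θ - 2 * π + -θ)) : ℝ) : ℂ) = ((5 * π / 4 : ℝ) : ℂ) by push_cast; ring, cexp_five_pi_div_four]
  rw [show ∀ a b c : ℂ, -a * b * c = -(b * (a * c)) from fun a b c => by ring, e1, e2,
    weightW1_eq_weightU1_mul, weightV_eq_sqrt_two_mul]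
  push_cast
  linear_combination ((weightU1 θ : ℂ) * ((√2 : ℂ) / 2) * Complex.sin (3 * (θ : ℂ) / 8)) * Complex.I_sq

/-- `e^{iπ/4} = (√2/2)(1 + i)`. [folklore] -/
private theorem cexp_pi_div_four : Complex.exp (((π / 4 : ℝ) : ℂ) * Complex.I) = (((√2 / 2) : ℝ) : ℂ) + (((√2 / 2) : ℝ) : ℂ) * Complex.I := by
  rw [cexp_real_mul_I, Real.cos_pi_div_four, Real.sin_pi_div_four]

/-- `e^{−iπ/2} = −i`. [folklore] -/
private theorem cexp_neg_pi_div_two : Complex.exp (((-(π / 2) : ℝ) : ℂ) * Complex.I) = -Complex.I := by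
  rw [cexp_real_mul_I, Real.cos_neg, Real.sin_neg, Real.cos_pi_div_two, Real.sin_pi_div_two]; push_cast; ring

/-- ★ **Class `{E,N}` at the root side `W`** (opposite side + θ-corner partner):
`backBracket(θ; W, E, N, S) = i·v(θ)·e^{i(3θ/8 − π/8)}`. [cite: GlazmanManolescu2019, Lemma 2.1 (statement, "in the form given in [Gl]"); Glazman2015WeightedSAW, Lemma 3.1 (proof), eq. (1)] -/
theorem backBracket_W_E_N_S (θ : ℝ) : backBracket θ .W .E .N .S =
    Complex.I * (weightV θ : ℂ) * Complex.exp (((3 * θ / 8 - π / 8 : ℝ) : ℂ) * Complex.I) := by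
  unfold backBracket
  simp only [crCoef, arcWeight, pairWeight, localWeight, arcKind, arcTurn, excursionWinding, phase]
  -- Q := e^{i3π/8}; ex := e^{i3θ/8}; R := e^{iπ/4}
  have e1 : Complex.exp (((-(5 / 8 * (θ - (π + θ))) : ℝ) : ℂ) * Complex.I) =
      Complex.exp (((3 * π / 8 : ℝ) : ℂ) * Complex.I) * ((((√2 / 2) : ℝ) : ℂ) + (((√2 / 2) : ℝ) : ℂ) * Complex.I) := by
    rw [show ((-(5 / 8 * (θ - (π + θ))) : ℝ) : ℂ) * Complex.I = ((3 * π / 8 : ℝ) : ℂ) * Complex.I + ((π / 4 : ℝ) : ℂ) * Complex.I by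
      push_cast; ring, Complex.exp_add, cexp_pi_div_four]
  have e2 : Complex.exp ((θ : ℂ) * Complex.I) * Complex.exp (((-(5 / 8 * (θ - (π + θ) + θ)) : ℝ) : ℂ) * Complex.I) =
      ((Real.cos (3 * θ / 8) : ℂ) + (Real.sin (3 * θ / 8) : ℂ) * Complex.I) *
        (Complex.exp (((3 * π / 8 : ℝ) : ℂ) * Complex.I) * ((((√2 / 2) : ℝ) : ℂ) + (((√2 / 2) : ℝ) : ℂ) * Complex.I)) := by
    rw [← Complex.exp_add, show (θ : ℂ) * Complex.I + ((-(5 / 8 * (θ - (π + θ) + θ)) : ℝ) : ℂ) * Complex.I =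
      ((3 * θ / 8 : ℝ) : ℂ) * Complex.I + (((3 * π / 8 : ℝ) : ℂ) * Complex.I + ((π / 4 : ℝ) : ℂ) * Complex.I) by push_cast; ring,
      Complex.exp_add, Complex.exp_add, cexp_real_mul_I, cexp_pi_div_four]
  have e3 : Complex.exp (((3 * θ / 8 - π / 8 : ℝ) : ℂ) * Complex.I) =
      -Complex.I * (((Real.cos (3 * θ / 8) : ℂ) + (Real.sin (3 * θ / 8) : ℂ) * Complex.I) *
        Complex.exp (((3 * π / 8 : ℝ) : ℂ) * Complex.I)) := by
    rw [show ((3 * θ / 8 - π / 8 : ℝ) : ℂ) * Complex.I =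
      ((-(π / 2) : ℝ) : ℂ) * Complex.I + (((3 * θ / 8 : ℝ) : ℂ) * Complex.I + ((3 * π / 8 : ℝ) : ℂ) * Complex.I) by push_cast; ring,
      Complex.exp_add, Complex.exp_add, cexp_neg_pi_div_two, cexp_real_mul_I]
  rw [show ∀ a b c : ℂ, -a * b * c = -(b * (a * c)) from fun a b c => by ring, e1, e2, e3,
    weightW1_eq_weightU1_mul, weightV_eq_sqrt_two_mul]
  push_cast
  linear_combination ((weightU1 θ : ℂ) * Complex.exp (3 * (π : ℂ) / 8 * Complex.I) * (√2 : ℂ) *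
      (Complex.cos (3 * (θ : ℂ) / 8) * Complex.sin (3 * (θ : ℂ) / 8) / 2 + Complex.sin (3 * (θ : ℂ) / 8) ^ 2 / 2 +
        Complex.I * Complex.sin (3 * (θ : ℂ) / 8) ^ 2)) * Complex.I_sq +
    (-((weightU1 θ : ℂ) * Complex.exp (3 * (π : ℂ) / 8 * Complex.I) * (√2 : ℂ)) * (1 + Complex.I) / 2) *
      Complex.cos_sq_add_sin_sq (3 * (θ : ℂ) / 8)

/-- `sin(3π/4) = √2/2`. [folklore] -/
private theorem sin_three_pi_div_four : Real.sin (3 * π / 4) = √2 / 2 := by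
  rw [show 3 * π / 4 = π / 4 + π / 2 by ring, Real.sin_add_pi_div_two, Real.cos_pi_div_four]

/-- `cos(3π/4) = −√2/2`. [folklore] -/
private theorem cos_three_pi_div_four : Real.cos (3 * π / 4) = -(√2 / 2) := by
  rw [show 3 * π / 4 = π / 4 + π / 2 by ring, Real.cos_add_pi_div_two, Real.sin_pi_div_four]

/-- `w₂ = √2·u₂·sin(3θ/8 − π/8)` — an identity between the weights of eq. (1). [cite: GlazmanManolescu2019, eq. (1)] -/
theorem weightW2_eq_sqrt_two_mul (θ : ℝ) : weightW2 θ = √2 * weightU2 θ * Real.sin (3 * θ / 8 - π / 8) := by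
  unfold weightW2 weightU2
  rw [mul_div_assoc', div_mul_eq_mul_div]
  congr 1
  rw [show 15 * π / 8 + 3 * θ / 8 = (3 * θ / 8 - π / 8) + 2 * π by ring, Real.sin_add_two_pi, sin_five_pi_div_four,
    Real.sin_neg]
  have h2 : √2 * √2 = 2 := Real.mul_self_sqrt (by norm_num)
  linear_combination ((1/2 : ℝ) * Real.sin (3 * θ / 8 - π / 8) * Real.sin (3 * θ / 8)) * h2

/-- `v = u₂·(cos(3θ/8 − π/8) − sin(3θ/8 − π/8))` — an identity between the weights of eq. (1). [cite: GlazmanManolescu2019, eq. (1)] -/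
theorem weightV_eq_weightU2_mul (θ : ℝ) : weightV θ = weightU2 θ * (Real.cos (3 * θ / 8 - π / 8) - Real.sin (3 * θ / 8 - π / 8)) := by
  unfold weightV weightU2
  rw [div_mul_eq_mul_div]
  congr 1
  rw [show 5 * π / 8 + 3 * θ / 8 = (3 * θ / 8 - π / 8) + 3 * π / 4 by ring, Real.sin_add, sin_three_pi_div_four,
    cos_three_pi_div_four, sin_five_pi_div_four, Real.sin_neg]
  ring

/-- `e^{i3π/4} = (√2/2)(−1 + i)`. [folklore] -/
private theorem cexp_three_pi_div_four : Complex.exp (((3 * π / 4 : ℝ) : ℂ) * Complex.I) = ((-(√2 / 2) : ℝ) : ℂ) + (((√2 / 2) : ℝ) : ℂ) * Complex.I := by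
  rw [cexp_real_mul_I, cos_three_pi_div_four, sin_three_pi_div_four]

/-- `e^{iπ/2} = i`. [folklore] -/
private theorem cexp_pi_div_two : Complex.exp (((π / 2 : ℝ) : ℂ) * Complex.I) = Complex.I := by
  rw [cexp_real_mul_I, Real.cos_pi_div_two, Real.sin_pi_div_two]; push_cast; ring

/-- ★ **Class `{E,S}` at the root side `W`** (opposite side + co-corner partner):
`backBracket(θ; W, E, S, N) = −i·v(θ)·e^{i(3θ/8 − π/4)}`. [cite: GlazmanManolescu2019, Lemma 2.1 (statement, "in the form given in [Gl]"); Glazman2015WeightedSAW, Lemma 3.1 (proof), eq. (1)] -/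
theorem backBracket_W_E_S_N (θ : ℝ) : backBracket θ .W .E .S .N =
    -Complex.I * (weightV θ : ℂ) * Complex.exp (((3 * θ / 8 - π / 4 : ℝ) : ℂ) * Complex.I) := by
  unfold backBracket
  simp only [crCoef, arcWeight, pairWeight, localWeight, arcKind, arcTurn, excursionWinding, phase]
  -- P := e^{-i5π/8}; ey := e^{iy}, y = 3θ/8 - π/8
  have e1 : Complex.exp (((-(5 / 8 * (θ - π - (-2 * π + θ))) : ℝ) : ℂ) * Complex.I) =
      Complex.exp (((-(5 * π / 8) : ℝ) : ℂ) * Complex.I) := by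
    congr 1; push_cast; ring
  have e2 : Complex.exp ((θ : ℂ) * Complex.I) * Complex.exp (((-(5 / 8 * (θ - π - (-2 * π + θ) + (θ - π))) : ℝ) : ℂ) * Complex.I) =
      ((Real.cos (3 * θ / 8 - π / 8) : ℂ) + (Real.sin (3 * θ / 8 - π / 8) : ℂ) * Complex.I) *
        Complex.exp (((-(5 * π / 8) : ℝ) : ℂ) * Complex.I) * (((-(√2 / 2) : ℝ) : ℂ) + (((√2 / 2) : ℝ) : ℂ) * Complex.I) := by
    rw [← Complex.exp_add, show (θ : ℂ) * Complex.I + ((-(5 / 8 * (θ - π - (-2 * π + θ) + (θ - π))) : ℝ) : ℂ) * Complex.I =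
      ((3 * θ / 8 - π / 8 : ℝ) : ℂ) * Complex.I + ((-(5 * π / 8) : ℝ) : ℂ) * Complex.I + ((3 * π / 4 : ℝ) : ℂ) * Complex.I by
        push_cast; ring, Complex.exp_add, Complex.exp_add, cexp_real_mul_I, cexp_three_pi_div_four]
  have e3 : Complex.exp (((3 * θ / 8 - π / 4 : ℝ) : ℂ) * Complex.I) =
      ((Real.cos (3 * θ / 8 - π / 8) : ℂ) + (Real.sin (3 * θ / 8 - π / 8) : ℂ) * Complex.I) *
        Complex.exp (((-(5 * π / 8) : ℝ) : ℂ) * Complex.I) * Complex.I := by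
    rw [show ((3 * θ / 8 - π / 4 : ℝ) : ℂ) * Complex.I =
      ((3 * θ / 8 - π / 8 : ℝ) : ℂ) * Complex.I + ((-(5 * π / 8) : ℝ) : ℂ) * Complex.I + ((π / 2 : ℝ) : ℂ) * Complex.I by
        push_cast; ring, Complex.exp_add, Complex.exp_add, cexp_real_mul_I, cexp_pi_div_two]
  have h2 : √2 * √2 = 2 := Real.mul_self_sqrt (by norm_num)
  have h2c : (√2 : ℂ) * (√2 : ℂ) = 2 := by exact_mod_cast h2
  have e2' : Complex.exp ((θ : ℂ) * Complex.I) * (weightW2 θ : ℂ) *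
      Complex.exp (((-(5 / 8 * (θ - π - (-2 * π + θ) + (θ - π))) : ℝ) : ℂ) * Complex.I) =
      (weightW2 θ : ℂ) * (((Real.cos (3 * θ / 8 - π / 8) : ℂ) + (Real.sin (3 * θ / 8 - π / 8) : ℂ) * Complex.I) *
        Complex.exp (((-(5 * π / 8) : ℝ) : ℂ) * Complex.I) * (((-(√2 / 2) : ℝ) : ℂ) + (((√2 / 2) : ℝ) : ℂ) * Complex.I)) := by
    rw [mul_right_comm, e2]; ring
  rw [e1, e2', e3, weightW2_eq_sqrt_two_mul, weightV_eq_weightU2_mul]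
  push_cast
  linear_combination
    ((weightU2 θ : ℂ) * Complex.sin (3 * (θ : ℂ) / 8 - (π : ℂ) / 8) * Complex.exp (-(5 * (π : ℂ) / 8) * Complex.I) * (1 / 2) *
      (-Complex.cos (3 * (θ : ℂ) / 8 - (π : ℂ) / 8) + Complex.cos (3 * (θ : ℂ) / 8 - (π : ℂ) / 8) * Complex.I -
        Complex.sin (3 * (θ : ℂ) / 8 - (π : ℂ) / 8) * Complex.I + Complex.sin (3 * (θ : ℂ) / 8 - (π : ℂ) / 8) * Complex.I ^ 2)) * h2c +
    ((weightU2 θ : ℂ) * Complex.exp (-(5 * (π : ℂ) / 8) * Complex.I) *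
      (Complex.sin (3 * (θ : ℂ) / 8 - (π : ℂ) / 8) ^ 2 + Complex.cos (3 * (θ : ℂ) / 8 - (π : ℂ) / 8) ^ 2 +
        Complex.cos (3 * (θ : ℂ) / 8 - (π : ℂ) / 8) * Complex.sin (3 * (θ : ℂ) / 8 - (π : ℂ) / 8) * Complex.I -
        Complex.sin (3 * (θ : ℂ) / 8 - (π : ℂ) / 8) * Complex.cos (3 * (θ : ℂ) / 8 - (π : ℂ) / 8) -
        Complex.sin (3 * (θ : ℂ) / 8 - (π : ℂ) / 8) ^ 2 * Complex.I)) * Complex.I_sq +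
    (-(weightU2 θ : ℂ) * Complex.exp (-(5 * (π : ℂ) / 8) * Complex.I)) * Complex.cos_sq_add_sin_sq (3 * (θ : ℂ) / 8 - (π : ℂ) / 8)

/-- `Re(v·e^{iρ}) = v·cos ρ`. [folklore] -/
private theorem re_ofReal_mul_cexp (v ρ : ℝ) : ((v : ℂ) * Complex.exp ((ρ : ℂ) * Complex.I)).re = v * Real.cos ρ := by
  rw [cexp_real_mul_I]
  simp only [Complex.mul_re, Complex.add_re, Complex.add_im, Complex.mul_im, Complex.ofReal_re, Complex.ofReal_im,
    Complex.I_re, Complex.I_im]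
  ring

/-- ★★ **EXPLICIT-DIRECTION (CONE) LEMMA for the root side `W`**: for θ ∈ [π/3, 2π/3] the three signed class
directions `ε·backBracket(θ; W, c, fourth)` (chord-rule signs ε(W;{S,N}) = ε(W;{E,N}) = −1, ε(W;{E,S}) = +1), turned by `i`,
all have real part `≥ v(θ)·cos(π/8)` (`≥ 0`, and `> 0` whenever `v > 0`): they lie in one open half-plane, within `π/8` of
`−i·v`. With the root-plaquette class expansion and the sign rule this gives `|VF_D(w.side W, w)| ≥ v·cos(π/8)·(wound mass)`.
[cite: GlazmanManolescu2019, Lemma 2.1 (statement, "in the form given in [Gl]"); Glazman2015WeightedSAW, Lemma 3.1 (proof), eq. (1)] -/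
theorem backBracket_cone_W {θ : ℝ} (hθ : θ ∈ Set.Icc (π / 3) (2 * π / 3)) :
    weightV θ * Real.cos (π / 8) ≤ (Complex.I * (-backBracket θ .W .S .N .E)).re ∧
      weightV θ * Real.cos (π / 8) ≤ (Complex.I * (-backBracket θ .W .E .N .S)).re ∧
        weightV θ * Real.cos (π / 8) ≤ (Complex.I * backBracket θ .W .E .S .N).re := by
  have hv := weightV_nonneg hθ
  have hc1 : Real.cos (π / 8) ≤ 1 := Real.cos_le_one _
  obtain ⟨h1, h2⟩ := hθ
  refine ⟨?_, ?_, ?_⟩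
  · rw [backBracket_W_S_N_E, show Complex.I * -(Complex.I * (weightV θ : ℂ)) = ((weightV θ * 1 : ℝ) : ℂ) by
      push_cast; linear_combination (-(weightV θ : ℂ)) * Complex.I_sq, Complex.ofReal_re]
    exact mul_le_mul_of_nonneg_left hc1 hv
  · rw [backBracket_W_E_N_S, show Complex.I * -(Complex.I * (weightV θ : ℂ) * Complex.exp (((3 * θ / 8 - π / 8 : ℝ) : ℂ) * Complex.I)) =
      (weightV θ : ℂ) * Complex.exp (((3 * θ / 8 - π / 8 : ℝ) : ℂ) * Complex.I) by
        linear_combination (-(weightV θ : ℂ) * Complex.exp (((3 * θ / 8 - π / 8 : ℝ) : ℂ) * Complex.I)) * Complex.I_sq,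
      re_ofReal_mul_cexp]
    refine mul_le_mul_of_nonneg_left ?_ hv
    exact Real.cos_le_cos_of_nonneg_of_le_pi (by linarith) (by linarith [Real.pi_pos]) (by linarith)
  · rw [backBracket_W_E_S_N, show Complex.I * (-Complex.I * (weightV θ : ℂ) * Complex.exp (((3 * θ / 8 - π / 4 : ℝ) : ℂ) * Complex.I)) =
      (weightV θ : ℂ) * Complex.exp (((3 * θ / 8 - π / 4 : ℝ) : ℂ) * Complex.I) by
        linear_combination (-(weightV θ : ℂ) * Complex.exp (((3 * θ / 8 - π / 4 : ℝ) : ℂ) * Complex.I)) * Complex.I_sq,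
      re_ofReal_mul_cexp, ← Real.cos_neg (3 * θ / 8 - π / 4)]
    refine mul_le_mul_of_nonneg_left ?_ hv
    exact Real.cos_le_cos_of_nonneg_of_le_pi (by linarith) (by linarith [Real.pi_pos]) (by linarith)

end Literature.Probability.RandomPlanarGeometry.SAW.YangBaxter

/-! ## Rider (Part 6c): the explicit class directions at the root sides `E`, `S`, `N` (Lemma E complete)

For the two classes containing the opposite side `σ̄`, orienting the excursion to RETURN at `σ̄` makes the first arc of
the backward group straight (weight `v`) and its two-arc companion of weight `0`, so `backBracket` is a single
explicit term `±v·e^{i(affine)}`; the adjacent class is the two-term identity of Part 6b up to a symmetry. With the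
chord-rule signs the three directions of every root side lie within `π/8` of the ray `−i·v·crCoef(σ̄)`
(`backBracket_cone_W/E/S/N`).
-/

namespace Literature.Probability.RandomPlanarGeometry.SAW.YangBaxter

open Real Complex

/-! ### helper rotations -/

/-- exponential bookkeeping. [folklore] -/
private theorem cexp_ofReal_congr {A B : ℝ} (h : A = B) :
    Complex.exp ((A : ℂ) * Complex.I) = Complex.exp ((B : ℂ) * Complex.I) := by rw [h]

/-- exponential bookkeeping. [folklore] -/
private theorem cexp_theta_mul_cexp (θ A B : ℝ) (h : θ + A = B) :
    Complex.exp ((θ : ℂ) * Complex.I) * Complex.exp ((A : ℂ) * Complex.I) = Complex.exp ((B : ℂ) * Complex.I) := by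
  rw [← Complex.exp_add, ← h]; push_cast; ring_nf

/-- exponential bookkeeping. [folklore] -/
private theorem cexp_add_real (A B : ℝ) :
    Complex.exp (((A + B : ℝ) : ℂ) * Complex.I) = Complex.exp ((A : ℂ) * Complex.I) * Complex.exp ((B : ℂ) * Complex.I) := by
  rw [← Complex.exp_add]; congr 1; push_cast; ring

/-- exponential bookkeeping. [folklore] -/
private theorem cexp_pi' : Complex.exp (((π : ℝ) : ℂ) * Complex.I) = -1 := by
  rw [cexp_real_mul_I, Real.cos_pi, Real.sin_pi]; push_cast; ring

/-- exponential bookkeeping. [folklore] -/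
private theorem cexp_two_pi' : Complex.exp (((2 * π : ℝ) : ℂ) * Complex.I) = 1 := by
  rw [cexp_real_mul_I, Real.cos_two_pi, Real.sin_two_pi]; push_cast; ring

/-! ### root side E -/

/-- ★ **Class `{S,W}` at the root side `E`** (orientation `S → W`, fourth side `N`): `backBracket = −v·e^{i(3θ/8 − 5π/8)}` —
modulus `v(θ)`, affine phase. [cite: GlazmanManolescu2019, Lemma 2.1 (statement, "in the form given in [Gl]"); Glazman2015WeightedSAW, Lemma 3.1 (proof), eq. (1)] -/
theorem backBracket_E_S_W_N (θ : ℝ) : backBracket θ .E .S .W .N =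
    -(weightV θ : ℂ) * Complex.exp (((3 * θ / 8 - 5 * π / 8 : ℝ) : ℂ) * Complex.I) := by
  unfold backBracket
  simp only [crCoef, arcWeight, pairWeight, localWeight, arcKind, arcTurn, excursionWinding, phase]
  simp only [Complex.ofReal_zero, mul_zero, zero_mul, add_zero]
  have k := cexp_theta_mul_cexp θ (-(5 / 8 * (0 - (-π - θ)))) (3 * θ / 8 - 5 * π / 8) (by ring)
  linear_combination (-(weightV θ : ℂ)) * k

/-- ★ **Class `{N,W}` at the root side `E`** (orientation `N → W`, fourth side `S`): `backBracket = v·e^{i(3θ/8 + 5π/4)}` —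
modulus `v(θ)`, affine phase. [cite: GlazmanManolescu2019, Lemma 2.1 (statement, "in the form given in [Gl]"); Glazman2015WeightedSAW, Lemma 3.1 (proof), eq. (1)] -/
theorem backBracket_E_N_W_S (θ : ℝ) : backBracket θ .E .N .W .S =
    (weightV θ : ℂ) * Complex.exp (((3 * θ / 8 + 5 * π / 4 : ℝ) : ℂ) * Complex.I) := by
  unfold backBracket
  simp only [crCoef, arcWeight, pairWeight, localWeight, arcKind, arcTurn, excursionWinding, phase]
  simp only [Complex.ofReal_zero, mul_zero, zero_mul, add_zero]
  have k := cexp_theta_mul_cexp θ (-(5 / 8 * (0 - (2 * π - θ)))) (3 * θ / 8 + 5 * π / 4) (by ring)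
  linear_combination (weightV θ : ℂ) * k

/-- ★ **Class `{N,S}` at the root side `E`** (orientation `N → S`, fourth side `W`): `backBracket = −i·v` —
modulus `v(θ)`, affine phase. [cite: GlazmanManolescu2019, Lemma 2.1 (statement, "in the form given in [Gl]"); Glazman2015WeightedSAW, Lemma 3.1 (proof), eq. (1)] -/
theorem backBracket_E_N_S_W (θ : ℝ) : backBracket θ .E .N .S .W = -(Complex.I * (weightV θ : ℂ)) := by
  unfold backBracket
  simp only [crCoef, arcWeight, pairWeight, localWeight, arcKind, arcTurn, excursionWinding, phase]
  have e1 : Complex.exp ((θ : ℂ) * Complex.I) * Complex.exp (((-(5 / 8 * (θ - 2 * π)) : ℝ) : ℂ) * Complex.I) =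
      ((Real.cos (3 * θ / 8) : ℂ) + (Real.sin (3 * θ / 8) : ℂ) * Complex.I) * (((-(√2 / 2) : ℝ) : ℂ) + ((-(√2 / 2) : ℝ) : ℂ) * Complex.I) := by
    rw [← Complex.exp_add, show (θ : ℂ) * Complex.I + ((-(5 / 8 * (θ - 2 * π)) : ℝ) : ℂ) * Complex.I =
      ((3 * θ / 8 : ℝ) : ℂ) * Complex.I + ((5 * π / 4 : ℝ) : ℂ) * Complex.I by push_cast; ring, Complex.exp_add,
      cexp_real_mul_I, cexp_five_pi_div_four]
  have e2 : Complex.exp (((-(5 / 8 * (θ - 2 * π + -θ)) : ℝ) : ℂ) * Complex.I) = ((-(√2 / 2) : ℝ) : ℂ) + ((-(√2 / 2) : ℝ) : ℂ) * Complex.I := by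
    rw [show ((-(5 / 8 * (θ - 2 * π + -θ)) : ℝ) : ℂ) = ((5 * π / 4 : ℝ) : ℂ) by push_cast; ring, cexp_five_pi_div_four]
  rw [mul_right_comm (Complex.exp ((θ : ℂ) * Complex.I)) ((weightU1 θ : ℂ)), e1, e2,
    weightW1_eq_weightU1_mul, weightV_eq_sqrt_two_mul]
  push_cast
  have hI : Complex.I * Complex.I = -1 := Complex.I_mul_I
  have hcs := Complex.cos_sq_add_sin_sq (3 * (θ : ℂ) / 8)
  grind

/-! ### root side S -/

/-- ★ **Class `{W,N}` at the root side `S`** (orientation `W → N`, fourth side `E`): `backBracket = −v·e^{i(5θ/8 − 5π/4)}` —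
modulus `v(θ)`, affine phase. [cite: GlazmanManolescu2019, Lemma 2.1 (statement, "in the form given in [Gl]"); Glazman2015WeightedSAW, Lemma 3.1 (proof), eq. (1)] -/
theorem backBracket_S_W_N_E (θ : ℝ) : backBracket θ .S .W .N .E =
    -(weightV θ : ℂ) * Complex.exp (((5 * θ / 8 - 5 * π / 4 : ℝ) : ℂ) * Complex.I) := by
  unfold backBracket
  simp only [crCoef, arcWeight, pairWeight, localWeight, arcKind, arcTurn, excursionWinding, phase]
  simp only [Complex.ofReal_zero, mul_zero, zero_mul, add_zero]
  have k := @cexp_ofReal_congr (-(5 / 8 * (0 - (-2 * π + θ)))) (5 * θ / 8 - 5 * π / 4) (by ring)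
  linear_combination (-(weightV θ : ℂ)) * k

/-- ★ **Class `{E,N}` at the root side `S`** (orientation `E → N`, fourth side `W`): `backBracket = v·e^{i(5θ/8 + 5π/8)}` —
modulus `v(θ)`, affine phase. [cite: GlazmanManolescu2019, Lemma 2.1 (statement, "in the form given in [Gl]"); Glazman2015WeightedSAW, Lemma 3.1 (proof), eq. (1)] -/
theorem backBracket_S_E_N_W (θ : ℝ) : backBracket θ .S .E .N .W =
    (weightV θ : ℂ) * Complex.exp (((5 * θ / 8 + 5 * π / 8 : ℝ) : ℂ) * Complex.I) := by
  unfold backBracket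
  simp only [crCoef, arcWeight, pairWeight, localWeight, arcKind, arcTurn, excursionWinding, phase]
  simp only [Complex.ofReal_zero, mul_zero, zero_mul, add_zero]
  have k := @cexp_ofReal_congr (-(5 / 8 * (0 - (π + θ)))) (5 * θ / 8 + 5 * π / 8) (by ring)
  linear_combination (weightV θ : ℂ) * k

/-- ★ **Class `{W,E}` at the root side `S`** (orientation `W → E`, fourth side `N`): `backBracket = −i·v·e^{iθ}` —
modulus `v(θ)`, affine phase. [cite: GlazmanManolescu2019, Lemma 2.1 (statement, "in the form given in [Gl]"); Glazman2015WeightedSAW, Lemma 3.1 (proof), eq. (1)] -/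
theorem backBracket_S_W_E_N (θ : ℝ) : backBracket θ .S .W .E .N =
    -Complex.I * (weightV θ : ℂ) * Complex.exp ((θ : ℂ) * Complex.I) := by
  unfold backBracket
  simp only [crCoef, arcWeight, pairWeight, localWeight, arcKind, arcTurn, excursionWinding, phase]
  have ePbar : Complex.exp (((-(5 * π / 4) : ℝ) : ℂ) * Complex.I) = ((-(√2 / 2) : ℝ) : ℂ) + (((√2 / 2) : ℝ) : ℂ) * Complex.I := by
    rw [cexp_real_mul_I, Real.cos_neg, Real.sin_neg, cos_five_pi_div_four, sin_five_pi_div_four]; push_cast; ring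
  have e1 : Complex.exp (((-(5 / 8 * (-θ - -2 * π)) : ℝ) : ℂ) * Complex.I) =
      Complex.exp ((θ : ℂ) * Complex.I) * ((Real.cos (3 * θ / 8) : ℂ) - (Real.sin (3 * θ / 8) : ℂ) * Complex.I) *
        (((-(√2 / 2) : ℝ) : ℂ) + (((√2 / 2) : ℝ) : ℂ) * Complex.I) := by
    rw [show ((-(5 / 8 * (-θ - -2 * π)) : ℝ) : ℂ) * Complex.I =
      (θ : ℂ) * Complex.I + ((-(3 * θ / 8) : ℝ) : ℂ) * Complex.I + ((-(5 * π / 4) : ℝ) : ℂ) * Complex.I by push_cast; ring,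
      Complex.exp_add, Complex.exp_add, cexp_real_mul_I (-(3 * θ / 8)), ePbar, Real.cos_neg, Real.sin_neg]
    push_cast; ring
  have e2 : Complex.exp (((-(5 / 8 * (-θ - -2 * π + θ)) : ℝ) : ℂ) * Complex.I) =
      ((-(√2 / 2) : ℝ) : ℂ) + (((√2 / 2) : ℝ) : ℂ) * Complex.I := by
    rw [show ((-(5 / 8 * (-θ - -2 * π + θ)) : ℝ) : ℂ) = ((-(5 * π / 4) : ℝ) : ℂ) by push_cast; ring]
    rw [← ePbar]
  rw [e1, e2, weightW1_eq_weightU1_mul, weightV_eq_sqrt_two_mul]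
  push_cast
  have hI : Complex.I * Complex.I = -1 := Complex.I_mul_I
  have hcs := Complex.cos_sq_add_sin_sq (3 * (θ : ℂ) / 8)
  grind

/-! ### root side N -/

/-- ★ **Class `{W,S}` at the root side `N`** (orientation `W → S`, fourth side `E`): `backBracket = −v·e^{i(5θ/8 + 5π/8)}` —
modulus `v(θ)`, affine phase. [cite: GlazmanManolescu2019, Lemma 2.1 (statement, "in the form given in [Gl]"); Glazman2015WeightedSAW, Lemma 3.1 (proof), eq. (1)] -/
theorem backBracket_N_W_S_E (θ : ℝ) : backBracket θ .N .W .S .E =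
    -(weightV θ : ℂ) * Complex.exp (((5 * θ / 8 + 5 * π / 8 : ℝ) : ℂ) * Complex.I) := by
  unfold backBracket
  simp only [crCoef, arcWeight, pairWeight, localWeight, arcKind, arcTurn, excursionWinding, phase]
  simp only [Complex.ofReal_zero, mul_zero, zero_mul, add_zero]
  have k := @cexp_ofReal_congr (-(5 / 8 * (0 - (π + θ)))) (5 * θ / 8 + 5 * π / 8) (by ring)
  linear_combination (-(weightV θ : ℂ)) * k

/-- ★ **Class `{E,S}` at the root side `N`** (orientation `E → S`, fourth side `W`): `backBracket = v·e^{i(5θ/8 − 5π/4)}` —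
modulus `v(θ)`, affine phase. [cite: GlazmanManolescu2019, Lemma 2.1 (statement, "in the form given in [Gl]"); Glazman2015WeightedSAW, Lemma 3.1 (proof), eq. (1)] -/
theorem backBracket_N_E_S_W (θ : ℝ) : backBracket θ .N .E .S .W =
    (weightV θ : ℂ) * Complex.exp (((5 * θ / 8 - 5 * π / 4 : ℝ) : ℂ) * Complex.I) := by
  unfold backBracket
  simp only [crCoef, arcWeight, pairWeight, localWeight, arcKind, arcTurn, excursionWinding, phase]
  simp only [Complex.ofReal_zero, mul_zero, zero_mul, add_zero]
  have k := @cexp_ofReal_congr (-(5 / 8 * (0 - (-2 * π + θ)))) (5 * θ / 8 - 5 * π / 4) (by ring)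
  linear_combination (weightV θ : ℂ) * k

/-- ★ **Class `{E,W}` at the root side `N`** (orientation `E → W`, fourth side `S`): `backBracket = i·v·e^{iθ}` —
modulus `v(θ)`, affine phase. [cite: GlazmanManolescu2019, Lemma 2.1 (statement, "in the form given in [Gl]"); Glazman2015WeightedSAW, Lemma 3.1 (proof), eq. (1)] -/
theorem backBracket_N_E_W_S (θ : ℝ) : backBracket θ .N .E .W .S =
    Complex.I * (weightV θ : ℂ) * Complex.exp ((θ : ℂ) * Complex.I) := by
  rw [show backBracket θ .N .E .W .S = -backBracket θ .S .W .E .N by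
    unfold backBracket
    simp only [crCoef, arcWeight, pairWeight, localWeight, arcKind, arcTurn, excursionWinding, phase]
    ring, backBracket_S_W_E_N]
  ring


/-! ### cone lemmas for the root sides E, S, N -/

/-- `e^{i(A+2π)} = e^{iA}`. [folklore] -/
private theorem cexp_add_two_pi_real (A : ℝ) :
    Complex.exp (((A + 2 * π : ℝ) : ℂ) * Complex.I) = Complex.exp ((A : ℂ) * Complex.I) := by
  rw [cexp_add_real, cexp_two_pi', mul_one]

/-- `e^{i(A+π)} = −e^{iA}`. [folklore] -/
private theorem cexp_add_pi_real (A : ℝ) :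
    Complex.exp (((A + π : ℝ) : ℂ) * Complex.I) = -Complex.exp ((A : ℂ) * Complex.I) := by
  rw [cexp_add_real, cexp_pi']; ring

/-- `cos(π/8) ≤ cos ρ` for `ρ ∈ [0, π/8]`. [folklore] -/
private theorem cos_bound_pos {ρ : ℝ} (h0 : 0 ≤ ρ) (h1 : ρ ≤ π / 8) : Real.cos (π / 8) ≤ Real.cos ρ :=
  Real.cos_le_cos_of_nonneg_of_le_pi h0 (by linarith [Real.pi_pos]) h1

/-- `cos(π/8) ≤ cos ρ` for `ρ ∈ [−π/8, 0]`. [folklore] -/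
private theorem cos_bound_neg {ρ : ℝ} (h0 : -(π / 8) ≤ ρ) (h1 : ρ ≤ 0) : Real.cos (π / 8) ≤ Real.cos ρ := by
  rw [← Real.cos_neg ρ]; exact Real.cos_le_cos_of_nonneg_of_le_pi (by linarith) (by linarith [Real.pi_pos]) (by linarith)

/-- ★★ **EXPLICIT-DIRECTION (CONE) LEMMA for the root side `E`**: for θ ∈ [π/3, 2π/3] the three chord-signed class
directions `ε·backBracket` (orientations (S,W) ε=+1, (N,W) ε=−1, (N,S) ε=−1), rotated by `−i` (the inverse of `−i·crCoef(σ̄)`), have real part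
`≥ v(θ)·cos(π/8)`: all within `π/8` of one ray. [cite: GlazmanManolescu2019, Lemma 2.1 (statement, "in the form given in [Gl]"); Glazman2015WeightedSAW, Lemma 3.1 (proof), eq. (1)] -/
theorem backBracket_cone_E {θ : ℝ} (hθ : θ ∈ Set.Icc (π / 3) (2 * π / 3)) :
    weightV θ * Real.cos (π / 8) ≤ (-Complex.I * backBracket θ .E .S .W .N).re ∧
      weightV θ * Real.cos (π / 8) ≤ (-Complex.I * (-backBracket θ .E .N .W .S)).re ∧
        weightV θ * Real.cos (π / 8) ≤ (-Complex.I * (-backBracket θ .E .N .S .W)).re := by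
  have hv := weightV_nonneg hθ
  obtain ⟨h1, h2⟩ := hθ
  refine ⟨?_, ?_, ?_⟩
  · rw [backBracket_E_S_W_N, show -Complex.I * (-(weightV θ : ℂ) * Complex.exp (((3 * θ / 8 - 5 * π / 8 : ℝ) : ℂ) * Complex.I)) =
        (weightV θ : ℂ) * (Complex.exp (((π / 2 : ℝ) : ℂ) * Complex.I) * Complex.exp (((3 * θ / 8 - 5 * π / 8 : ℝ) : ℂ) * Complex.I)) by
          rw [cexp_pi_div_two]; ring,
      ← cexp_add_real, cexp_ofReal_congr (show π / 2 + (3 * θ / 8 - 5 * π / 8) = 3 * θ / 8 - π / 8 by ring), re_ofReal_mul_cexp]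
    exact mul_le_mul_of_nonneg_left (cos_bound_pos (by linarith) (by linarith)) hv
  · rw [backBracket_E_N_W_S, show -Complex.I * -((weightV θ : ℂ) * Complex.exp (((3 * θ / 8 + 5 * π / 4 : ℝ) : ℂ) * Complex.I)) =
        (weightV θ : ℂ) * (Complex.exp (((π / 2 : ℝ) : ℂ) * Complex.I) * Complex.exp (((3 * θ / 8 + 5 * π / 4 : ℝ) : ℂ) * Complex.I)) by
          rw [cexp_pi_div_two]; ring,
      ← cexp_add_real, cexp_ofReal_congr (show π / 2 + (3 * θ / 8 + 5 * π / 4) = (3 * θ / 8 - π / 4) + 2 * π by ring),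
      cexp_add_two_pi_real, re_ofReal_mul_cexp]
    exact mul_le_mul_of_nonneg_left (cos_bound_neg (by linarith) (by linarith)) hv
  · rw [backBracket_E_N_S_W, show -Complex.I * -(-(Complex.I * (weightV θ : ℂ))) = ((weightV θ * 1 : ℝ) : ℂ) by
        push_cast; linear_combination (-(weightV θ : ℂ)) * Complex.I_sq, Complex.ofReal_re]
    exact mul_le_mul_of_nonneg_left (Real.cos_le_one _) hv

/-- ★★ **EXPLICIT-DIRECTION (CONE) LEMMA for the root side `S`**: for θ ∈ [π/3, 2π/3] the three chord-signed class
directions `ε·backBracket` (orientations (W,N) ε=+1, (E,N) ε=−1, (W,E) ε=+1), rotated by `i·e^{−iθ}` (the inverse of `−i·crCoef(σ̄)`), have real part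
`≥ v(θ)·cos(π/8)`: all within `π/8` of one ray. [cite: GlazmanManolescu2019, Lemma 2.1 (statement, "in the form given in [Gl]"); Glazman2015WeightedSAW, Lemma 3.1 (proof), eq. (1)] -/
theorem backBracket_cone_S {θ : ℝ} (hθ : θ ∈ Set.Icc (π / 3) (2 * π / 3)) :
    weightV θ * Real.cos (π / 8) ≤ (Complex.I * Complex.exp (((-θ : ℝ) : ℂ) * Complex.I) * backBracket θ .S .W .N .E).re ∧
      weightV θ * Real.cos (π / 8) ≤ (Complex.I * Complex.exp (((-θ : ℝ) : ℂ) * Complex.I) * (-backBracket θ .S .E .N .W)).re ∧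
        weightV θ * Real.cos (π / 8) ≤ (Complex.I * Complex.exp (((-θ : ℝ) : ℂ) * Complex.I) * backBracket θ .S .W .E .N).re := by
  have hv := weightV_nonneg hθ
  obtain ⟨h1, h2⟩ := hθ
  refine ⟨?_, ?_, ?_⟩
  · rw [backBracket_S_W_N_E, show Complex.I * Complex.exp (((-θ : ℝ) : ℂ) * Complex.I) *
        (-(weightV θ : ℂ) * Complex.exp (((5 * θ / 8 - 5 * π / 4 : ℝ) : ℂ) * Complex.I)) =
        (weightV θ : ℂ) * -(Complex.exp (((π / 2 : ℝ) : ℂ) * Complex.I) * Complex.exp (((-θ : ℝ) : ℂ) * Complex.I) *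
          Complex.exp (((5 * θ / 8 - 5 * π / 4 : ℝ) : ℂ) * Complex.I)) by rw [cexp_pi_div_two]; ring,
      ← cexp_add_real, ← cexp_add_real, ← cexp_add_pi_real,
      cexp_ofReal_congr (show π / 2 + -θ + (5 * θ / 8 - 5 * π / 4) + π = -(3 * θ / 8) + π / 4 by ring), re_ofReal_mul_cexp]
    exact mul_le_mul_of_nonneg_left (cos_bound_pos (by linarith) (by linarith)) hv
  · rw [backBracket_S_E_N_W, show Complex.I * Complex.exp (((-θ : ℝ) : ℂ) * Complex.I) *
        -((weightV θ : ℂ) * Complex.exp (((5 * θ / 8 + 5 * π / 8 : ℝ) : ℂ) * Complex.I)) =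
        (weightV θ : ℂ) * -(Complex.exp (((π / 2 : ℝ) : ℂ) * Complex.I) * Complex.exp (((-θ : ℝ) : ℂ) * Complex.I) *
          Complex.exp (((5 * θ / 8 + 5 * π / 8 : ℝ) : ℂ) * Complex.I)) by rw [cexp_pi_div_two]; ring,
      ← cexp_add_real, ← cexp_add_real, ← cexp_add_pi_real,
      cexp_ofReal_congr (show π / 2 + -θ + (5 * θ / 8 + 5 * π / 8) + π = (-(3 * θ / 8) + π / 8) + 2 * π by ring),
      cexp_add_two_pi_real, re_ofReal_mul_cexp]
    exact mul_le_mul_of_nonneg_left (cos_bound_neg (by linarith) (by linarith)) hv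
  · rw [backBracket_S_W_E_N, show Complex.I * Complex.exp (((-θ : ℝ) : ℂ) * Complex.I) *
        (-Complex.I * (weightV θ : ℂ) * Complex.exp ((θ : ℂ) * Complex.I)) =
        (weightV θ : ℂ) * (Complex.exp (((-θ : ℝ) : ℂ) * Complex.I) * Complex.exp (((θ : ℝ) : ℂ) * Complex.I)) by
          push_cast; linear_combination (-(weightV θ : ℂ) * Complex.exp (-(θ : ℂ) * Complex.I) * Complex.exp ((θ : ℂ) * Complex.I)) * Complex.I_sq,
      ← cexp_add_real, cexp_ofReal_congr (show -θ + θ = (0 : ℝ) by ring), re_ofReal_mul_cexp, Real.cos_zero, mul_one]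
    exact mul_le_mul_of_nonneg_left (Real.cos_le_one _) hv |>.trans (le_of_eq (by ring))

/-- ★★ **EXPLICIT-DIRECTION (CONE) LEMMA for the root side `N`**: for θ ∈ [π/3, 2π/3] the three chord-signed class
directions `ε·backBracket` (orientations (W,S) ε=−1, (E,S) ε=+1, (E,W) ε=+1), rotated by `−i·e^{−iθ}` (the inverse of `−i·crCoef(σ̄)`), have real part
`≥ v(θ)·cos(π/8)`: all within `π/8` of one ray. [cite: GlazmanManolescu2019, Lemma 2.1 (statement, "in the form given in [Gl]"); Glazman2015WeightedSAW, Lemma 3.1 (proof), eq. (1)] -/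
theorem backBracket_cone_N {θ : ℝ} (hθ : θ ∈ Set.Icc (π / 3) (2 * π / 3)) :
    weightV θ * Real.cos (π / 8) ≤ (-Complex.I * Complex.exp (((-θ : ℝ) : ℂ) * Complex.I) * (-backBracket θ .N .W .S .E)).re ∧
      weightV θ * Real.cos (π / 8) ≤ (-Complex.I * Complex.exp (((-θ : ℝ) : ℂ) * Complex.I) * backBracket θ .N .E .S .W).re ∧
        weightV θ * Real.cos (π / 8) ≤ (-Complex.I * Complex.exp (((-θ : ℝ) : ℂ) * Complex.I) * backBracket θ .N .E .W .S).re := by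
  have hv := weightV_nonneg hθ
  obtain ⟨h1, h2⟩ := hθ
  refine ⟨?_, ?_, ?_⟩
  · rw [backBracket_N_W_S_E, show -Complex.I * Complex.exp (((-θ : ℝ) : ℂ) * Complex.I) *
        -(-(weightV θ : ℂ) * Complex.exp (((5 * θ / 8 + 5 * π / 8 : ℝ) : ℂ) * Complex.I)) =
        (weightV θ : ℂ) * (Complex.exp (((-(π / 2) : ℝ) : ℂ) * Complex.I) * Complex.exp (((-θ : ℝ) : ℂ) * Complex.I) *
          Complex.exp (((5 * θ / 8 + 5 * π / 8 : ℝ) : ℂ) * Complex.I)) by rw [cexp_neg_pi_div_two]; ring,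
      ← cexp_add_real, ← cexp_add_real,
      cexp_ofReal_congr (show -(π / 2) + -θ + (5 * θ / 8 + 5 * π / 8) = -(3 * θ / 8) + π / 8 by ring), re_ofReal_mul_cexp]
    exact mul_le_mul_of_nonneg_left (cos_bound_neg (by linarith) (by linarith)) hv
  · rw [backBracket_N_E_S_W, show -Complex.I * Complex.exp (((-θ : ℝ) : ℂ) * Complex.I) *
        ((weightV θ : ℂ) * Complex.exp (((5 * θ / 8 - 5 * π / 4 : ℝ) : ℂ) * Complex.I)) =
        (weightV θ : ℂ) * (Complex.exp (((-(π / 2) : ℝ) : ℂ) * Complex.I) * Complex.exp (((-θ : ℝ) : ℂ) * Complex.I) *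
          Complex.exp (((5 * θ / 8 - 5 * π / 4 : ℝ) : ℂ) * Complex.I)) by rw [cexp_neg_pi_div_two]; ring,
      ← cexp_add_real, ← cexp_add_real,
      cexp_ofReal_congr (show -(π / 2) + -θ + (5 * θ / 8 - 5 * π / 4) = (-(3 * θ / 8) + π / 4) + -(2 * π) by ring),
      show ∀ A : ℝ, Complex.exp (((A + -(2 * π) : ℝ) : ℂ) * Complex.I) = Complex.exp ((A : ℂ) * Complex.I) from fun A => by
        rw [← cexp_add_two_pi_real (A + -(2 * π))]; exact cexp_ofReal_congr (by ring),
      re_ofReal_mul_cexp]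
    exact mul_le_mul_of_nonneg_left (cos_bound_pos (by linarith) (by linarith)) hv
  · rw [backBracket_N_E_W_S, show -Complex.I * Complex.exp (((-θ : ℝ) : ℂ) * Complex.I) *
        (Complex.I * (weightV θ : ℂ) * Complex.exp ((θ : ℂ) * Complex.I)) =
        (weightV θ : ℂ) * (Complex.exp (((-θ : ℝ) : ℂ) * Complex.I) * Complex.exp (((θ : ℝ) : ℂ) * Complex.I)) by
          push_cast; linear_combination (-(weightV θ : ℂ) * Complex.exp (-(θ : ℂ) * Complex.I) * Complex.exp ((θ : ℂ) * Complex.I)) * Complex.I_sq,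
      ← cexp_add_real, cexp_ofReal_congr (show -θ + θ = (0 : ℝ) by ring), re_ofReal_mul_cexp, Real.cos_zero, mul_one]
    exact mul_le_mul_of_nonneg_left (Real.cos_le_one _) hv |>.trans (le_of_eq (by ring))

end Literature.Probability.RandomPlanarGeometry.SAW.YangBaxter
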